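import Literature.Analysis.FunctionSpaces.BMOCarlesonProofs
import Literature.Analysis.FunctionSpaces.PlancherelL1L2
import Literature.Analysis.UnboundedOperators.HeatKernelGradient
import Mathlib.Analysis.Fourier.Convolution
import Mathlib.Analysis.Fourier.FourierTransformDeriv
import Mathlib.Analysis.SpecialFunctions.ImproperIntegrals
import Mathlib.Analysis.SpecialFunctions.Pow.Integral
import Mathlib.Analysis.SpecialFunctions.Gamma.Basic
import Mathlib.Analysis.SpecialFunctions.JapaneseBracket
import Mathlib.MeasureTheory.Function.SpecialFunctions.Inner
import HarnessLib

/-!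
# Fefferman–Stein `BMO ⇒ Carleson` for the heat extension, from the John–Nirenberg inequality

Topic `Analysis/FunctionSpaces`; third file of the Koch–Tataru cluster
(`BMOCarleson.lean`: statement of the decomposition of `Literature.Analysis.FunctionSpaces.memBMOInv_iff_carleson_heat`
(Koch–Tataru 2001, Theorem 1) into the named facts (A)–(E); `BMOCarlesonProofs.lean`: (A) and (C)
discharged). This file **proves fact (B)** — the direction `BMO ⇒ Carleson` of the
Fefferman–Stein characterisation of `BMO` in the heat-kernel form of Koch–Tataru's Definition 1.1,
`sup_{x,R} R^{-d} ∫₀^{R²}∫_{B(x,R)} |∇e^{tΔ}f|² dy dt ≤ C ‖f‖²_*` (Grafakos, *Modern Fourier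
Analysis*, 3rd ed., Theorem 3.3.8 (b); Stein, *Harmonic Analysis*, IV §4.3) — **from the
John–Nirenberg inequality** `Literature.Analysis.FunctionSpaces.john_nirenberg` (John–Nirenberg 1961, Lemma 1'; a named fact of
`BMO.lean`), and records the resulting assembly of Koch–Tataru's Theorem 1 from John–Nirenberg,
(D) and (E): `Literature.Analysis.FunctionSpaces.memBMOInv_iff_carleson_heat_of_JN_D_E`.

## The proof (Grafakos, proof of Theorem 3.3.8 (b), transcribed to the caloric extension)

Fix `f ∈ BMO`, a ball `B = B(x, R)`, `B* = B(x, 2R)`, `c = f_{B*}`, and split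
`f = c + f₁ + f₂`, `f₁ = (f - c) 1_{B*}`, `f₂ = (f - c) 1_{B*ᶜ}`. Since `∫ ∇K_t = 0`,
`∇e^{tΔ}f = ∇e^{tΔ}f₁ + ∇e^{tΔ}f₂` (`heatExtensionGrad_eq_near_add_far`).

* *Near part.* By Plancherel (`Literature/.../PlancherelL1L2.lean`), the convolution theorem
  (Mathlib's `Real.fourier_mul_convolution_eq`) and `𝓕(∂ᵥK_t)(ξ) = 2πi⟨ξ,v⟩e^{-4π²t|ξ|²}`,
  `∫ |∇e^{tΔ}g|² dy = ∫ |ĝ|² 4π²|ξ|² e^{-8π²t|ξ|²} dξ` for `g ∈ L¹ ∩ L²`; Tonelli and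
  `∫₀^∞ 4π²|ξ|²e^{-8π²t|ξ|²} dt = ½` give the **energy inequality**
  `∫₀^∞∫ |∇e^{tΔ}g|² ≤ ½‖g‖₂²` (`lintegral_Ioi_lintegral_enorm_heatExtensionGrad_sq_le`).
  With `g = f₁` and the `L²` oscillation bound `∫_{B*}|f - c|² ≤ (2c₁/c₂²)‖f‖²_*|B*|`, which is
  where John–Nirenberg enters (layer-cake formula, `exists_lintegral_ball_enorm_sub_average_sq_le`,
  Grafakos Cor. 3.1.9), the near part is `O(‖f‖²_* R^d)`.
* *Far part.* The kernel decay `‖w‖^{d+1}‖∇K_t(w)‖ ≤ 2(d+2)!` uniformly in `t`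
  (`norm_pow_mul_norm_heatKernelGrad_le`) and the tail estimate
  `∫_{|z-x|≥r}|f - f_{B(x,r)}| |z-x|^{-(d+1)} ≤ C_d |B(0,1)| ‖f‖_*/r` (dyadic shells, Grafakos
  Prop. 3.1.5 (ii); `MemBMO.lintegral_compl_ball_enorm_sub_average_mul_le`) give
  `|∇e^{tΔ}f₂(y)| ≤ C ‖f‖_*/R` on `B` (`enorm_heatExtensionGrad_far_le`), whose square integrated
  over the box `B × (0, R²)` is again `O(‖f‖²_* R^d)`.

## Main statements (all proved)

* `Literature.Analysis.FunctionSpaces.BMOInv.norm_pow_mul_norm_heatKernelGrad_le`, `Literature.Analysis.FunctionSpaces.MemBMO.lintegral_compl_ball_enorm_sub_average_mul_le`,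
  `Literature.Analysis.FunctionSpaces.exists_lintegral_ball_enorm_sub_average_sq_le` — kernel decay, tail estimate, `L²` bound.
* `Literature.Analysis.FunctionSpaces.BMOInv.fourier_ofReal_heatKernel`, `Literature.Analysis.FunctionSpaces.BMOInv.fourier_ofReal_inner_heatKernelGrad` —
  `𝓕 K_t = e^{-4π²t|ξ|²}`, `𝓕 ∂ᵥK_t = 2πi⟨ξ,v⟩ e^{-4π²t|ξ|²}` (Mathlib's Fourier convention).
* `Literature.Analysis.FunctionSpaces.BMOInv.lintegral_enorm_heatExtensionGrad_sq` (Plancherel for `∇e^{tΔ}g`) and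
  `Literature.Analysis.FunctionSpaces.BMOInv.lintegral_Ioi_lintegral_enorm_heatExtensionGrad_sq_le` (the energy inequality).
* `Literature.Analysis.FunctionSpaces.BMOInv.heatExtensionGrad_eq_near_add_far`, `Literature.Analysis.FunctionSpaces.BMOInv.enorm_heatExtensionGrad_far_le`,
  `Literature.Analysis.FunctionSpaces.BMOInv.lintegral_carlesonBox_le` — the splitting, the far part, the box estimate.
* `Literature.BMOInv.eCarlesonGradNorm_le_of_memBMO_of_john_nirenberg :
    john_nirenberg → eCarlesonGradNorm_le_of_memBMO` — **fact (B) from John–Nirenberg**.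
* `Literature.Analysis.FunctionSpaces.memBMOInv_iff_carleson_heat_of_JN_D_E` — Koch–Tataru's Theorem 1 from John–Nirenberg,
  (D) and (E) (with (A), (B), (C) discharged).

## References

* L. Grafakos, *Modern Fourier Analysis*, 3rd ed., GTM 250 (2014), Prop. 3.1.5, Cor. 3.1.9,
  Thm. 3.3.8 (b). [GrafakosMFA2014]
* F. John, L. Nirenberg, *On functions of bounded mean oscillation*, CPAM 14 (1961), Lemma 1'.
  [JohnNirenberg1961]
* C. Fefferman, E. M. Stein, *Hᵖ spaces of several variables*, Acta Math. 129 (1972). [FeffermanStein1972]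
* E. M. Stein, *Harmonic Analysis* (1993), Ch. IV §4.3. [SteinHA1993]
* H. Koch, D. Tataru, *Well-posedness for the Navier–Stokes equations*, Adv. Math. 157 (2001),
  Definition 1.1 and Theorem 1. [KochTataruAdvMath2001]
-/

noncomputable section

open MeasureTheory Metric Filter Topology FourierTransform Convolution
open scoped ENNReal NNReal RealInnerProductSpace

namespace Literature.Analysis.FunctionSpaces

namespace BMOInv

section KernelBound

variable {E : Type*} [NormedAddCommGroup E] [InnerProductSpace ℝ E]

/-- The norm of the gradient of the heat kernel: `‖∇K_t(w)‖ = (2t)⁻¹ K_t(w) ‖w‖` for `t > 0`. [folklore] -/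
theorem norm_heatKernelGrad {t : ℝ} (ht : 0 < t) (w : E) :
    ‖heatKernelGrad t w‖ = (2 * t)⁻¹ * heatKernel t w * ‖w‖ := by
  have hK : 0 ≤ heatKernel t w := (Literature.Analysis.UnboundedOperators.heatKernel_pos ht w).le
  rw [heatKernelGrad, norm_smul, norm_mul, norm_neg, norm_inv, Real.norm_of_nonneg (by positivity),
    Real.norm_of_nonneg hK]

/-- **Off-diagonal decay of the gradient of the heat kernel, uniformly in time**:
`‖w‖^{d+1} ‖∇K_t(w)‖ ≤ 2 (d+2)!` for all `t > 0`, `w ∈ E`, `d = dim E` (the scaling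
`∇K_t(w) = t^{-(d+1)/2} ∇K_1(w/√t)` and the Gaussian decay of `∇K_1`; proved by comparing squares,
`(‖w‖^{d+1}‖∇K_t(w)‖)² = 4 π^{-d} s^{d+2} e^{-2s}` with `s = ‖w‖²/(4t)`). [folklore] -/
theorem norm_pow_mul_norm_heatKernelGrad_le [FiniteDimensional ℝ E] {t : ℝ} (ht : 0 < t) (w : E) :
    ‖w‖ ^ (Module.finrank ℝ E + 1) * ‖heatKernelGrad t w‖ ≤
      2 * (Module.finrank ℝ E + 2).factorial := by
  set d := Module.finrank ℝ E with hd
  have hK : 0 ≤ heatKernel t w := (Literature.Analysis.UnboundedOperators.heatKernel_pos ht w).le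
  have hlhs : 0 ≤ ‖w‖ ^ (d + 1) * ‖heatKernelGrad t w‖ := by positivity
  have hrhs : (0 : ℝ) ≤ 2 * (d + 2).factorial := by positivity
  rw [← pow_le_pow_iff_left₀ hlhs hrhs two_ne_zero]
  -- compute the square of the left-hand side
  set s := ‖w‖ ^ 2 / (4 * t) with hs
  have hs0 : 0 ≤ s := by positivity
  have hA : ((4 * Real.pi * t) ^ (-(d : ℝ) / 2)) ^ 2 = ((4 * Real.pi * t) ^ d)⁻¹ := by
    rw [← Real.rpow_natCast, ← Real.rpow_mul (by positivity), ← Real.rpow_natCast _ d,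
      ← Real.rpow_neg (by positivity)]
    congr 1
    push_cast
    ring
  have hexp : (Real.exp (-‖w‖ ^ 2 / (4 * t))) ^ 2 = Real.exp (-(2 * s)) := by
    rw [← Real.exp_nat_mul]
    congr 1
    rw [hs]
    push_cast
    ring
  have hw2 : ‖w‖ ^ 2 = 4 * t * s := by
    rw [hs]; field_simp
  have hsq : (‖w‖ ^ (d + 1) * ‖heatKernelGrad t w‖) ^ 2 =
      4 * (Real.pi ^ d)⁻¹ * (s ^ (d + 2) * Real.exp (-(2 * s))) := by
    rw [norm_heatKernelGrad ht, heatKernel]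
    have e1 : (‖w‖ ^ (d + 1) * ((2 * t)⁻¹ * ((4 * Real.pi * t) ^ (-(d : ℝ) / 2) *
        Real.exp (-‖w‖ ^ 2 / (4 * t))) * ‖w‖)) ^ 2 =
        (‖w‖ ^ 2) ^ (d + 2) * ((2 * t)⁻¹) ^ 2 * ((4 * Real.pi * t) ^ (-(d : ℝ) / 2)) ^ 2 *
          (Real.exp (-‖w‖ ^ 2 / (4 * t))) ^ 2 := by ring
    rw [← hd, e1, hA, hexp, hw2]
    have hπ : (Real.pi : ℝ) ≠ 0 := Real.pi_pos.ne'
    have ht0 : t ≠ 0 := ht.ne'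
    rw [mul_pow, mul_pow, mul_pow]
    field_simp
    ring
  rw [hsq]
  -- bound it
  have h1 : s ^ (d + 2) * Real.exp (-(2 * s)) ≤ (d + 2).factorial :=
    (pow_mul_exp_neg_le two_pos (d + 2) hs0).trans
      (div_le_self (by positivity) (one_le_pow₀ (by norm_num)))
  have h2 : (Real.pi ^ d)⁻¹ ≤ 1 := by
    apply inv_le_one_of_one_le₀
    exact one_le_pow₀ (by linarith [Real.two_le_pi])
  have h3 : (1 : ℝ) ≤ (d + 2).factorial := by exact_mod_cast Nat.one_le_iff_ne_zero.mpr (Nat.factorial_ne_zero _)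
  have h4 : 4 * (Real.pi ^ d)⁻¹ * (s ^ (d + 2) * Real.exp (-(2 * s))) ≤ 4 * 1 * (d + 2).factorial := by
    gcongr
  calc 4 * (Real.pi ^ d)⁻¹ * (s ^ (d + 2) * Real.exp (-(2 * s))) ≤ 4 * 1 * (d + 2).factorial := h4
    _ ≤ (2 * ((d + 2).factorial : ℝ)) ^ 2 := by nlinarith

end KernelBound

end BMOInv


/-! ## The tail estimate for `BMO` functions (Grafakos Prop. 3.1.5 (ii), scaled) -/

section Tail

variable {E : Type*} [NormedAddCommGroup E] [InnerProductSpace ℝ E] [FiniteDimensional ℝ E]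
  [MeasurableSpace E] [BorelSpace E]

omit [InnerProductSpace ℝ E] [FiniteDimensional ℝ E] [MeasurableSpace E] [BorelSpace E] in
/-- The dyadic shells `B(x, 2^{k+1} r) ∖ B(x, 2^k r)`, `k ≥ 0`, cover the complement of `B(x, r)`. [folklore] -/
theorem compl_ball_subset_iUnion_shell [NormedSpace ℝ E] (x : E) {r : ℝ} (hr : 0 < r) :
    (ball x r)ᶜ ⊆ ⋃ k : ℕ, (ball x (2 ^ (k + 1) * r) \ ball x (2 ^ k * r)) := by
  intro z hz
  rw [Set.mem_compl_iff, mem_ball_iff_norm, not_lt] at hz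
  have h1 : 1 ≤ ‖z - x‖ / r := by rwa [le_div_iff₀ hr, one_mul]
  obtain ⟨k, hk1, hk2⟩ := exists_nat_pow_near h1 one_lt_two
  refine Set.mem_iUnion.mpr ⟨k, ?_, ?_⟩
  · rw [mem_ball_iff_norm]
    rw [div_lt_iff₀ hr] at hk2
    exact hk2
  · rw [mem_ball_iff_norm, not_lt]
    rw [le_div_iff₀ hr] at hk1
    exact hk1

/-- Summability of the shell weights `(1 + (k+1) 2^d) 2^{-k}`. [folklore] -/
theorem summable_shell_weights (d : ℕ) :
    Summable fun k : ℕ => (1 + (k + 1) * (2 : ℝ) ^ d) * (1 / 2 : ℝ) ^ k := by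
  have h1 : Summable fun k : ℕ => (1 + 2 ^ d : ℝ) * (1 / 2 : ℝ) ^ k :=
    (summable_geometric_of_lt_one (by norm_num) (by norm_num)).mul_left (1 + 2 ^ d : ℝ)
  have h2 : Summable fun k : ℕ => (2 : ℝ) ^ d * ((k : ℝ) ^ 1 * (1 / 2 : ℝ) ^ k) :=
    (summable_pow_mul_geometric_of_norm_lt_one 1 (by norm_num)).mul_left ((2 : ℝ) ^ d)
  refine (h1.add h2).congr fun k => ?_
  ring

/-- `Σ_k (1 + (k+1) 2^d) 2^{-k} = 2 + 4·2^d`. [folklore] -/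
theorem tsum_shell_weights (d : ℕ) :
    ∑' k : ℕ, (1 + (k + 1) * (2 : ℝ) ^ d) * (1 / 2 : ℝ) ^ k = 2 + 4 * 2 ^ d := by
  have h1 : Summable fun k : ℕ => (1 / 2 : ℝ) ^ k :=
    summable_geometric_of_lt_one (by norm_num) (by norm_num)
  have h2 : Summable fun k : ℕ => (k : ℝ) * (1 / 2 : ℝ) ^ k := by
    have := summable_pow_mul_geometric_of_norm_lt_one (R := ℝ) 1 (r := (1 / 2 : ℝ)) (by norm_num)
    simpa using this
  have e1 : ∑' k : ℕ, (1 / 2 : ℝ) ^ k = 2 := tsum_geometric_two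
  have e2 : ∑' k : ℕ, (k : ℝ) * (1 / 2 : ℝ) ^ k = 2 := by
    rw [tsum_coe_mul_geometric_of_norm_lt_one (by norm_num)]
    norm_num
  have e3 : (fun k : ℕ => (1 + (k + 1) * (2 : ℝ) ^ d) * (1 / 2 : ℝ) ^ k) =
      fun k : ℕ => (1 + 2 ^ d) * (1 / 2 : ℝ) ^ k + 2 ^ d * ((k : ℝ) * (1 / 2 : ℝ) ^ k) := by
    funext k
    ring
  rw [e3, (h1.mul_left (1 + 2 ^ d : ℝ)).tsum_add (h2.mul_left ((2 : ℝ) ^ d)), tsum_mul_left,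
    tsum_mul_left, e1, e2]
  ring

/-- The volume of a ball in terms of the unit ball (real-valued form of
`Measure.addHaar_ball_of_pos`). [folklore] -/
theorem volumeReal_ball_eq_pow_mul (x : E) {ρ : ℝ} (hρ : 0 < ρ) :
    volume.real (ball x ρ) = ρ ^ Module.finrank ℝ E * volume.real (ball (0 : E) 1) := by
  rw [measureReal_def, measureReal_def, Measure.addHaar_ball_of_pos _ x hρ, ENNReal.toReal_mul,
    ENNReal.toReal_ofReal (by positivity)]

namespace MemBMO

/-- Doubling step for ball averages of a `BMO` function: `|f_{B(x,2r)} - f_{B(x,r)}| ≤ 2^d ‖f‖_*`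
(Grafakos, *Modern Fourier Analysis*, 3rd ed., proof of Prop. 3.1.5 (i)). [folklore] -/
theorem abs_average_ball_two_mul_sub_le {f : E → ℝ} (hf : MemBMO f) (x : E) {r : ℝ} (hr : 0 < r) :
    |(⨍ z in ball x (2 * r), f z) - ⨍ z in ball x r, f z| ≤
      2 ^ Module.finrank ℝ E * (eBMOSeminorm f).toReal := by
  have h := hf.abs_average_sub_average_le (x := x) (x' := x) hr (by positivity : (0:ℝ) < 2 * r)
    (ball_subset_ball (by linarith))
  rw [abs_sub_comm, volumeReal_ball_two_mul x hr] at h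
  have hV : 0 < volume.real (ball x r) :=
    ENNReal.toReal_pos (measure_ball_pos volume x hr).ne' measure_ball_lt_top.ne
  have key : (volume.real (ball x r))⁻¹ * ((eBMOSeminorm f).toReal *
      (2 ^ Module.finrank ℝ E * volume.real (ball x r))) =
      2 ^ Module.finrank ℝ E * (eBMOSeminorm f).toReal := by
    field_simp
  rw [key] at h
  exact h

/-- Telescoping over dyadic dilates: `|f_{B(x,2^k r)} - f_{B(x,r)}| ≤ k 2^d ‖f‖_*`
(Grafakos, *Modern Fourier Analysis*, 3rd ed., Prop. 3.1.5 (i)). [folklore] -/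
theorem abs_average_ball_two_pow_mul_sub_le {f : E → ℝ} (hf : MemBMO f) (x : E) {r : ℝ}
    (hr : 0 < r) (k : ℕ) :
    |(⨍ z in ball x (2 ^ k * r), f z) - ⨍ z in ball x r, f z| ≤
      k * (2 ^ Module.finrank ℝ E * (eBMOSeminorm f).toReal) := by
  induction k with
  | zero => simp
  | succ k ih =>
    have h1 := abs_sub_le (⨍ z in ball x (2 ^ (k + 1) * r), f z)
      (⨍ z in ball x (2 ^ k * r), f z) (⨍ z in ball x r, f z)
    have h2 : |(⨍ z in ball x (2 ^ (k + 1) * r), f z) - ⨍ z in ball x (2 ^ k * r), f z| ≤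
        2 ^ Module.finrank ℝ E * (eBMOSeminorm f).toReal := by
      have := hf.abs_average_ball_two_mul_sub_le x (by positivity : (0:ℝ) < 2 ^ k * r)
      rwa [show (2 : ℝ) * (2 ^ k * r) = 2 ^ (k + 1) * r by ring] at this
    push_cast
    nlinarith [h1, h2, ih]

/-- Mass of `f - f_{B(x,r)}` on the dilate `B(x, 2^k r)`:
`∫_{B(x,2^k r)} |f - f_{B(x,r)}| ≤ (1 + k 2^d) ‖f‖_* |B(x, 2^k r)|`. [folklore] -/
theorem lintegral_ball_enorm_sub_average_le {f : E → ℝ} (hf : MemBMO f) (x : E) {r : ℝ}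
    (hr : 0 < r) (k : ℕ) :
    ∫⁻ z in ball x (2 ^ k * r), ‖f z - ⨍ w in ball x r, f w‖ₑ ≤
      ENNReal.ofReal ((1 + k * 2 ^ Module.finrank ℝ E) * (eBMOSeminorm f).toReal *
        volume.real (ball x (2 ^ k * r))) := by
  obtain ⟨S, hS⟩ : ∃ S : ℝ, S = (eBMOSeminorm f).toReal := ⟨_, rfl⟩
  obtain ⟨c, hc⟩ : ∃ c : ℝ, c = ⨍ w in ball x r, f w := ⟨_, rfl⟩
  obtain ⟨ck, hck⟩ : ∃ ck : ℝ, ck = ⨍ w in ball x (2 ^ k * r), f w := ⟨_, rfl⟩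
  rw [← hS, ← hc]
  have hrk : (0 : ℝ) < 2 ^ k * r := by positivity
  have hBtop : volume (ball x (2 ^ k * r)) ≠ ∞ := measure_ball_lt_top.ne
  have hint : IntegrableOn f (ball x (2 ^ k * r)) := hf.integrableOn_ball x _
  have hconst : IntegrableOn (fun _ : E => c) (ball x (2 ^ k * r)) :=
    integrableOn_const hBtop enorm_ne_top
  have hsub : IntegrableOn (fun z => f z - c) (ball x (2 ^ k * r)) := hint.sub hconst
  have hi1 : IntegrableOn (fun z => ‖f z - ck‖) (ball x (2 ^ k * r)) :=
    (hint.sub (integrableOn_const hBtop enorm_ne_top : IntegrableOn (fun _ : E => ck) _)).norm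
  have hi2 : IntegrableOn (fun _ : E => ‖ck - c‖) (ball x (2 ^ k * r)) :=
    integrableOn_const hBtop enorm_ne_top
  rw [← ofReal_integral_norm_eq_lintegral_enorm hsub]
  refine ENNReal.ofReal_le_ofReal ?_
  -- `|f - c| ≤ |f - c_k| + |c_k - c|`
  have h1 : ∫ z in ball x (2 ^ k * r), ‖f z - c‖ ≤
      ∫ z in ball x (2 ^ k * r), (‖f z - ck‖ + ‖ck - c‖) :=
    integral_mono hsub.norm (hi1.add hi2)
      fun z => by simpa using norm_sub_le_norm_sub_add_norm_sub (f z) ck c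
  have h2 : ∫ z in ball x (2 ^ k * r), (‖f z - ck‖ + ‖ck - c‖) =
      (∫ z in ball x (2 ^ k * r), ‖f z - ck‖) + ‖ck - c‖ * volume.real (ball x (2 ^ k * r)) := by
    rw [integral_add hi1 hi2, setIntegral_const, smul_eq_mul]
    ring
  have h3 : ∫ z in ball x (2 ^ k * r), ‖f z - ck‖ ≤ S * volume.real (ball x (2 ^ k * r)) := by
    rw [hS, hck]
    exact hf.setIntegral_norm_sub_average_le x hrk
  have h4 : ‖ck - c‖ ≤ k * (2 ^ Module.finrank ℝ E * S) := by
    rw [Real.norm_eq_abs, hck, hc, hS]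
    exact hf.abs_average_ball_two_pow_mul_sub_le x hr k
  have hV : 0 ≤ volume.real (ball x (2 ^ k * r)) := measureReal_nonneg
  have h5 : ‖ck - c‖ * volume.real (ball x (2 ^ k * r)) ≤
      k * (2 ^ Module.finrank ℝ E * S) * volume.real (ball x (2 ^ k * r)) := by gcongr
  have h6 : S * volume.real (ball x (2 ^ k * r)) +
      k * (2 ^ Module.finrank ℝ E * S) * volume.real (ball x (2 ^ k * r)) =
      (1 + k * 2 ^ Module.finrank ℝ E) * S * volume.real (ball x (2 ^ k * r)) := by ring
  linarith [h1, h2, h3, h5, h6]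

/-- One dyadic shell of the tail estimate: on `B(x,2^{k+1}r) ∖ B(x,2^k r)` the weight
`‖z - x‖^{-(d+1)}` is at most `(2^k r)^{-(d+1)}`, so the shell contributes at most
`r⁻¹ 2^d |B(0,1)| ‖f‖_* · (1 + (k+1)2^d) 2^{-k}`. [folklore] -/
theorem lintegral_shell_enorm_sub_average_mul_le {f : E → ℝ} (hf : MemBMO f) (x : E) {r : ℝ}
    (hr : 0 < r) (k : ℕ) :
    ∫⁻ z in ball x (2 ^ (k + 1) * r) \ ball x (2 ^ k * r),
        ‖f z - ⨍ w in ball x r, f w‖ₑ * ENNReal.ofReal ((‖z - x‖ ^ (Module.finrank ℝ E + 1))⁻¹) ≤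
      ENNReal.ofReal (r⁻¹ * (2 ^ Module.finrank ℝ E * volume.real (ball (0 : E) 1) *
        (eBMOSeminorm f).toReal) *
        ((1 + ((k + 1 : ℕ) : ℝ) * 2 ^ Module.finrank ℝ E) * (1 / 2 : ℝ) ^ k)) := by
  obtain ⟨d, hd⟩ : ∃ d : ℕ, d = Module.finrank ℝ E := ⟨_, rfl⟩
  obtain ⟨S, hS⟩ : ∃ S : ℝ, S = (eBMOSeminorm f).toReal := ⟨_, rfl⟩
  obtain ⟨V, hV⟩ : ∃ V : ℝ, V = volume.real (ball (0 : E) 1) := ⟨_, rfl⟩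
  rw [← hd, ← hS, ← hV]
  have hS0 : 0 ≤ S := hS ▸ ENNReal.toReal_nonneg
  have hV0 : 0 ≤ V := hV ▸ measureReal_nonneg
  have h2k : (0 : ℝ) < 2 ^ k * r := by positivity
  have hck : 0 ≤ ((2 ^ k * r) ^ (d + 1))⁻¹ := by positivity
  have step1 : ∫⁻ z in ball x (2 ^ (k + 1) * r) \ ball x (2 ^ k * r),
        ‖f z - ⨍ w in ball x r, f w‖ₑ * ENNReal.ofReal ((‖z - x‖ ^ (d + 1))⁻¹)
      ≤ ∫⁻ z in ball x (2 ^ (k + 1) * r) \ ball x (2 ^ k * r),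
        ‖f z - ⨍ w in ball x r, f w‖ₑ * ENNReal.ofReal (((2 ^ k * r) ^ (d + 1))⁻¹) := by
    refine setLIntegral_mono' (measurableSet_ball.diff measurableSet_ball) fun z hz => ?_
    have hz' : 2 ^ k * r ≤ ‖z - x‖ := by
      have := hz.2
      rwa [mem_ball_iff_norm, not_lt] at this
    gcongr
  have step2 : ∫⁻ z in ball x (2 ^ (k + 1) * r) \ ball x (2 ^ k * r),
        ‖f z - ⨍ w in ball x r, f w‖ₑ * ENNReal.ofReal (((2 ^ k * r) ^ (d + 1))⁻¹)
      ≤ ∫⁻ z in ball x (2 ^ (k + 1) * r),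
        ‖f z - ⨍ w in ball x r, f w‖ₑ * ENNReal.ofReal (((2 ^ k * r) ^ (d + 1))⁻¹) :=
    lintegral_mono_set Set.sdiff_subset
  have step3 : ∫⁻ z in ball x (2 ^ (k + 1) * r),
        ‖f z - ⨍ w in ball x r, f w‖ₑ * ENNReal.ofReal (((2 ^ k * r) ^ (d + 1))⁻¹) =
      (∫⁻ z in ball x (2 ^ (k + 1) * r), ‖f z - ⨍ w in ball x r, f w‖ₑ) *
          ENNReal.ofReal (((2 ^ k * r) ^ (d + 1))⁻¹) :=
    lintegral_mul_const' _ _ ENNReal.ofReal_ne_top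
  have step4 : (∫⁻ z in ball x (2 ^ (k + 1) * r), ‖f z - ⨍ w in ball x r, f w‖ₑ) *
          ENNReal.ofReal (((2 ^ k * r) ^ (d + 1))⁻¹) ≤
      ENNReal.ofReal ((1 + ((k + 1 : ℕ) : ℝ) * 2 ^ d) * S * volume.real (ball x (2 ^ (k + 1) * r))) *
          ENNReal.ofReal (((2 ^ k * r) ^ (d + 1))⁻¹) := by
    gcongr
    rw [hd, hS]
    exact hf.lintegral_ball_enorm_sub_average_le x hr (k + 1)
  have step5 : ENNReal.ofReal ((1 + ((k + 1 : ℕ) : ℝ) * 2 ^ d) * S *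
        volume.real (ball x (2 ^ (k + 1) * r))) * ENNReal.ofReal (((2 ^ k * r) ^ (d + 1))⁻¹) =
      ENNReal.ofReal (r⁻¹ * (2 ^ d * V * S) *
        ((1 + ((k + 1 : ℕ) : ℝ) * 2 ^ d) * (1 / 2 : ℝ) ^ k)) := by
    rw [← ENNReal.ofReal_mul' hck, volumeReal_ball_eq_pow_mul x (by positivity), ← hd, ← hV]
    congr 1
    have h2 : (2 : ℝ) ^ k ≠ 0 := by positivity
    have hr0 : r ≠ 0 := hr.ne'
    rw [one_div, inv_pow, pow_succ, mul_pow, mul_pow]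
    field_simp
    ring
  calc _ ≤ _ := step1
    _ ≤ _ := step2
    _ = _ := step3
    _ ≤ _ := step4
    _ = _ := step5

/-- **The tail estimate for `BMO` functions** (Grafakos, *Modern Fourier Analysis*, 3rd ed.,
Prop. 3.1.5 (ii) with `δ = 1`, rescaled to the ball `B(x, r)`):
`∫_{‖z-x‖ ≥ r} |f(z) - f_{B(x,r)}| ‖z - x‖^{-(d+1)} dz ≤ 2^{d+1} (1 + 2^{d+1}) |B(0,1)| ‖f‖_* / r`
(dyadic shells, using `|f_{B(x,2^k r)} - f_{B(x,r)}| ≤ k 2^d ‖f‖_*`). [cite: GrafakosMFA2014, Proposition 3.1.5 (ii)] -/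
theorem lintegral_compl_ball_enorm_sub_average_mul_le {f : E → ℝ} (hf : MemBMO f) (x : E) {r : ℝ}
    (hr : 0 < r) :
    ∫⁻ z in (ball x r)ᶜ, ‖f z - ⨍ w in ball x r, f w‖ₑ *
        ENNReal.ofReal ((‖z - x‖ ^ (Module.finrank ℝ E + 1))⁻¹) ≤
      ENNReal.ofReal (2 ^ (Module.finrank ℝ E + 1) * (1 + 2 ^ (Module.finrank ℝ E + 1)) *
        volume.real (ball (0 : E) 1) * (eBMOSeminorm f).toReal / r) := by
  obtain ⟨d, hd⟩ : ∃ d : ℕ, d = Module.finrank ℝ E := ⟨_, rfl⟩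
  obtain ⟨S, hS⟩ : ∃ S : ℝ, S = (eBMOSeminorm f).toReal := ⟨_, rfl⟩
  obtain ⟨V, hV⟩ : ∃ V : ℝ, V = volume.real (ball (0 : E) 1) := ⟨_, rfl⟩
  rw [← hd, ← hS, ← hV]
  have hS0 : 0 ≤ S := hS ▸ ENNReal.toReal_nonneg
  have hV0 : 0 ≤ V := hV ▸ measureReal_nonneg
  have hterm : ∀ k : ℕ, 0 ≤ r⁻¹ * (2 ^ d * V * S) *
      ((1 + ((k + 1 : ℕ) : ℝ) * 2 ^ d) * (1 / 2 : ℝ) ^ k) := fun k => by positivity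
  have hsum : Summable fun k : ℕ => r⁻¹ * (2 ^ d * V * S) *
      ((1 + ((k + 1 : ℕ) : ℝ) * 2 ^ d) * (1 / 2 : ℝ) ^ k) := by
    have := (summable_shell_weights d).mul_left (r⁻¹ * (2 ^ d * V * S))
    refine this.congr fun k => ?_
    push_cast
    ring
  have hshell : ∀ k : ℕ, ∫⁻ z in ball x (2 ^ (k + 1) * r) \ ball x (2 ^ k * r),
        ‖f z - ⨍ w in ball x r, f w‖ₑ * ENNReal.ofReal ((‖z - x‖ ^ (d + 1))⁻¹) ≤
      ENNReal.ofReal (r⁻¹ * (2 ^ d * V * S) *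
        ((1 + ((k + 1 : ℕ) : ℝ) * 2 ^ d) * (1 / 2 : ℝ) ^ k)) := by
    intro k
    have := hf.lintegral_shell_enorm_sub_average_mul_le x hr k
    rw [← hd, ← hS, ← hV] at this
    exact this
  have step1 : ∫⁻ z in (ball x r)ᶜ, ‖f z - ⨍ w in ball x r, f w‖ₑ *
        ENNReal.ofReal ((‖z - x‖ ^ (d + 1))⁻¹)
      ≤ ∫⁻ z in ⋃ k : ℕ, (ball x (2 ^ (k + 1) * r) \ ball x (2 ^ k * r)),
          ‖f z - ⨍ w in ball x r, f w‖ₑ * ENNReal.ofReal ((‖z - x‖ ^ (d + 1))⁻¹) :=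
    lintegral_mono_set (compl_ball_subset_iUnion_shell x hr)
  have step2 : ∫⁻ z in ⋃ k : ℕ, (ball x (2 ^ (k + 1) * r) \ ball x (2 ^ k * r)),
          ‖f z - ⨍ w in ball x r, f w‖ₑ * ENNReal.ofReal ((‖z - x‖ ^ (d + 1))⁻¹)
      ≤ ∑' k : ℕ, ∫⁻ z in ball x (2 ^ (k + 1) * r) \ ball x (2 ^ k * r),
          ‖f z - ⨍ w in ball x r, f w‖ₑ * ENNReal.ofReal ((‖z - x‖ ^ (d + 1))⁻¹) :=
    lintegral_iUnion_le _ _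
  have step3 : ∑' k : ℕ, ∫⁻ z in ball x (2 ^ (k + 1) * r) \ ball x (2 ^ k * r),
          ‖f z - ⨍ w in ball x r, f w‖ₑ * ENNReal.ofReal ((‖z - x‖ ^ (d + 1))⁻¹)
      ≤ ∑' k : ℕ, ENNReal.ofReal (r⁻¹ * (2 ^ d * V * S) *
          ((1 + ((k + 1 : ℕ) : ℝ) * 2 ^ d) * (1 / 2 : ℝ) ^ k)) :=
    ENNReal.tsum_le_tsum hshell
  have step4 : ∑' k : ℕ, ENNReal.ofReal (r⁻¹ * (2 ^ d * V * S) *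
          ((1 + ((k + 1 : ℕ) : ℝ) * 2 ^ d) * (1 / 2 : ℝ) ^ k)) =
      ENNReal.ofReal (∑' k : ℕ, r⁻¹ * (2 ^ d * V * S) *
          ((1 + ((k + 1 : ℕ) : ℝ) * 2 ^ d) * (1 / 2 : ℝ) ^ k)) :=
    (ENNReal.ofReal_tsum_of_nonneg hterm hsum).symm
  have step5 : ∑' k : ℕ, r⁻¹ * (2 ^ d * V * S) *
          ((1 + ((k + 1 : ℕ) : ℝ) * 2 ^ d) * (1 / 2 : ℝ) ^ k) =
      2 ^ (d + 1) * (1 + 2 ^ (d + 1)) * V * S / r := by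
    have e : (fun k : ℕ => r⁻¹ * (2 ^ d * V * S) *
          ((1 + ((k + 1 : ℕ) : ℝ) * 2 ^ d) * (1 / 2 : ℝ) ^ k)) =
        fun k : ℕ => r⁻¹ * (2 ^ d * V * S) * ((1 + (k + 1) * (2 : ℝ) ^ d) * (1 / 2 : ℝ) ^ k) := by
      funext k
      push_cast
      ring
    rw [e, tsum_mul_left, tsum_shell_weights]
    field_simp
    ring
  calc _ ≤ _ := step1
    _ ≤ _ := step2
    _ ≤ _ := step3
    _ = _ := step4
    _ = ENNReal.ofReal (2 ^ (d + 1) * (1 + 2 ^ (d + 1)) * V * S / r) := by rw [step5]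

end MemBMO

end Tail



section JN

universe u

variable {E : Type u} [NormedAddCommGroup E] [InnerProductSpace ℝ E] [FiniteDimensional ℝ E]
  [MeasurableSpace E] [BorelSpace E]

/-- `∫₀^∞ t e^{-a t} dt = a⁻²` for `a > 0`, in `ℝ≥0∞` form. [folklore] -/
theorem lintegral_Ioi_ofReal_mul_exp_neg_mul {a : ℝ} (ha : 0 < a) :
    ∫⁻ t in Set.Ioi (0 : ℝ), ENNReal.ofReal (t * Real.exp (-(a * t))) = ENNReal.ofReal (a ^ 2)⁻¹ := by
  have h := Real.integral_rpow_mul_exp_neg_mul_Ioi (a := 2) (r := a) (by norm_num) ha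
  have hG : Real.Gamma 2 = 1 := by
    rw [show (2 : ℝ) = 1 + 1 by norm_num, Real.Gamma_add_one one_ne_zero, Real.Gamma_one, mul_one]
  simp only [show (2 : ℝ) - 1 = 1 by norm_num, Real.rpow_one, hG, mul_one, Real.rpow_two, one_div,
    inv_pow] at h
  have hint : IntegrableOn (fun t : ℝ => t * Real.exp (-(a * t))) (Set.Ioi 0) := by
    by_contra hni
    rw [integral_undef hni] at h
    have : (0 : ℝ) < (a ^ 2)⁻¹ := by positivity
    linarith
  rw [← ofReal_integral_eq_lintegral_ofReal hint, h]
  filter_upwards [ae_restrict_mem measurableSet_Ioi] with t ht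
  exact mul_nonneg (le_of_lt ht) (Real.exp_nonneg _)

/-- **`L²` oscillation bound for `BMO` from the John–Nirenberg inequality**
(John–Nirenberg 1961; Grafakos, *Modern Fourier Analysis*, 3rd ed., Cor. 3.1.9 with `p = 2`;
Stein, *Harmonic Analysis*, IV.1.3): given the John–Nirenberg inequality with constants
`c₁, c₂`, every `f ∈ BMO(E)` satisfies `∫_B |f - f_B|² ≤ (2c₁/c₂²) ‖f‖²_* |B|` for all balls `B`
(layer-cake formula `∫|h|² = 2∫₀^∞ t |{|h| > t}| dt` and `∫₀^∞ t c₁ e^{-c₂ t/‖f‖_*} dt =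
c₁ ‖f‖²_*/c₂²`). [cite: GrafakosMFA2014, Corollary 3.1.9] -/
theorem exists_lintegral_ball_enorm_sub_average_sq_le (hJN : john_nirenberg.{u, 0}) :
    ∃ C : ℝ≥0, ∀ (f : E → ℝ), MemBMO f → ∀ (x : E) (r : ℝ), 0 < r →
      ∫⁻ y in ball x r, ‖f y - ⨍ z in ball x r, f z‖ₑ ^ 2 ≤
        C * eBMOSeminorm f ^ 2 * volume (ball x r) := by
  obtain ⟨c₁, c₂, hc₁, hc₂, hJ⟩ := hJN E ℝ
  refine ⟨(2 * c₁ / c₂ ^ 2).toNNReal, fun f hf x r hr => ?_⟩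
  have hC : (((2 * c₁ / c₂ ^ 2).toNNReal : ℝ≥0) : ℝ≥0∞) = ENNReal.ofReal (2 * c₁ / c₂ ^ 2) := rfl
  rw [hC]
  obtain ⟨c, hc⟩ : ∃ c : ℝ, c = ⨍ z in ball x r, f z := ⟨_, rfl⟩
  rw [← hc]
  have hBtop : volume (ball x r) ≠ ∞ := measure_ball_lt_top.ne
  have hB0 : volume (ball x r) ≠ 0 := (measure_ball_pos volume x hr).ne'
  have hStop : eBMOSeminorm f ≠ ∞ := hf.2.ne
  have hmeas : AEStronglyMeasurable (fun y => f y - c) (volume.restrict (ball x r)) :=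
    (hf.1.aestronglyMeasurable.sub aestronglyMeasurable_const).restrict
  -- the layer-cake representation
  have hlc : ∫⁻ y in ball x r, ‖f y - c‖ₑ ^ 2 =
      ENNReal.ofReal 2 * ∫⁻ t in Set.Ioi 0,
        volume.restrict (ball x r) {y | t < ‖f y - c‖} * ENNReal.ofReal (t ^ ((2 : ℝ) - 1)) := by
    rw [← lintegral_rpow_eq_lintegral_meas_lt_mul (volume.restrict (ball x r))
      (Eventually.of_forall fun y => norm_nonneg _) hmeas.norm.aemeasurable (by norm_num : (0:ℝ) < 2)]
    refine lintegral_congr fun y => ?_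
    rw [← ofReal_norm, ← ENNReal.ofReal_pow (norm_nonneg _)]
    norm_cast
  rcases eq_or_ne (eBMOSeminorm f) 0 with hS0 | hS0
  · -- `‖f‖_* = 0`: `f = c` a.e. on the ball
    have h1 : ∫⁻ y in ball x r, ‖f y - c‖ₑ = 0 := by
      have := laverage_oscillation_le_eBMOSeminorm f volume x hr
      rw [hS0, nonpos_iff_eq_zero, setLAverage_eq, ENNReal.div_eq_zero_iff] at this
      rcases this with h | h
      · rw [← hc] at h; exact h
      · exact absurd h hBtop
    have h2 : (fun y => ‖f y - c‖ₑ) =ᵐ[volume.restrict (ball x r)] 0 :=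
      (lintegral_eq_zero_iff' hmeas.enorm).mp h1
    have h3 : (fun y => ‖f y - c‖ₑ ^ 2) =ᵐ[volume.restrict (ball x r)] 0 := by
      filter_upwards [h2] with y hy
      simp only [Pi.zero_apply] at hy ⊢
      rw [hy]
      simp
    rw [lintegral_congr_ae h3]
    simp
  -- main case: `0 < ‖f‖_* < ∞`
  obtain ⟨s, hs⟩ : ∃ s : ℝ, s = (eBMOSeminorm f).toReal := ⟨_, rfl⟩
  have hs0 : 0 < s := hs ▸ ENNReal.toReal_pos hS0 hStop
  have hSofReal : ENNReal.ofReal s = eBMOSeminorm f := hs ▸ ENNReal.ofReal_toReal hStop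
  -- John–Nirenberg bound on the distribution function
  have hdist : ∀ t : ℝ, 0 < t →
      volume.restrict (ball x r) {y | t < ‖f y - c‖} ≤
        ENNReal.ofReal (c₁ * Real.exp (-c₂ * (t / s))) * volume (ball x r) := by
    intro t ht
    have hJt := hJ f hf x r hr (t / s) (by positivity)
    rw [Measure.restrict_apply' measurableSet_ball]
    have hset : {y | t < ‖f y - c‖} ∩ ball x r =
        {y ∈ ball x r | ENNReal.ofReal (t / s) * eBMOSeminorm f < ‖f y - ⨍ z in ball x r, f z‖ₑ} := by
      ext y
      simp only [Set.mem_inter_iff, Set.mem_setOf_eq]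
      rw [← hc, ← hSofReal, ← ENNReal.ofReal_mul (by positivity), div_mul_cancel₀ t hs0.ne',
        ← ofReal_norm, ENNReal.ofReal_lt_ofReal_iff_of_nonneg ht.le, and_comm]
    rw [hset]
    exact hJt
  -- integrate the bound
  have hI : ∫⁻ t in Set.Ioi 0,
        volume.restrict (ball x r) {y | t < ‖f y - c‖} * ENNReal.ofReal (t ^ ((2 : ℝ) - 1)) ≤
      ∫⁻ t in Set.Ioi 0, volume (ball x r) *
        ENNReal.ofReal (c₁ * (t * Real.exp (-((c₂ / s) * t)))) := by
    refine setLIntegral_mono' measurableSet_Ioi fun t ht => ?_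
    have ht' : (0 : ℝ) < t := ht
    calc volume.restrict (ball x r) {y | t < ‖f y - c‖} * ENNReal.ofReal (t ^ ((2 : ℝ) - 1))
        ≤ (ENNReal.ofReal (c₁ * Real.exp (-c₂ * (t / s))) * volume (ball x r)) *
            ENNReal.ofReal (t ^ ((2 : ℝ) - 1)) := by
          gcongr
          exact hdist t ht'
      _ = volume (ball x r) * ENNReal.ofReal (c₁ * (t * Real.exp (-((c₂ / s) * t)))) := by
          rw [show (2 : ℝ) - 1 = 1 by norm_num, Real.rpow_one, mul_comm (ENNReal.ofReal _) (volume _),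
            mul_assoc, ← ENNReal.ofReal_mul (by positivity)]
          congr 2
          rw [show -c₂ * (t / s) = -((c₂ / s) * t) by ring]
          ring
  have hval : ∫⁻ t in Set.Ioi 0, volume (ball x r) *
        ENNReal.ofReal (c₁ * (t * Real.exp (-((c₂ / s) * t)))) =
      volume (ball x r) * ENNReal.ofReal (c₁ * ((c₂ / s) ^ 2)⁻¹) := by
    rw [lintegral_const_mul' _ _ hBtop]
    congr 1
    have e1 : (fun t : ℝ => ENNReal.ofReal (c₁ * (t * Real.exp (-((c₂ / s) * t))))) =
        fun t : ℝ => ENNReal.ofReal c₁ * ENNReal.ofReal (t * Real.exp (-((c₂ / s) * t))) := by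
      funext t
      rw [ENNReal.ofReal_mul hc₁.le]
    rw [e1, lintegral_const_mul' _ _ ENNReal.ofReal_ne_top,
      lintegral_Ioi_ofReal_mul_exp_neg_mul (by positivity), ← ENNReal.ofReal_mul hc₁.le]
  -- assemble
  rw [hlc]
  have hfin : ENNReal.ofReal 2 * (volume (ball x r) * ENNReal.ofReal (c₁ * ((c₂ / s) ^ 2)⁻¹)) =
      ENNReal.ofReal (2 * c₁ / c₂ ^ 2) * eBMOSeminorm f ^ 2 * volume (ball x r) := by
    rw [← hSofReal, ← ENNReal.ofReal_pow hs0.le, ← ENNReal.ofReal_mul (by positivity),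
      mul_comm (volume _) _, ← mul_assoc, ← ENNReal.ofReal_mul (by positivity)]
    congr 1
    field_simp
  calc ENNReal.ofReal 2 * ∫⁻ t in Set.Ioi 0,
        volume.restrict (ball x r) {y | t < ‖f y - c‖} * ENNReal.ofReal (t ^ ((2 : ℝ) - 1))
      ≤ ENNReal.ofReal 2 * (volume (ball x r) * ENNReal.ofReal (c₁ * ((c₂ / s) ^ 2)⁻¹)) := by
        rw [← hval]
        gcongr
    _ = _ := hfin

end JN



namespace BMOInv

section KernelFourier

variable {E : Type*} [NormedAddCommGroup E] [InnerProductSpace ℝ E] [FiniteDimensional ℝ E]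
  [MeasurableSpace E] [BorelSpace E]

omit [MeasurableSpace E] [BorelSpace E] in
/-- The Fréchet derivative of the heat kernel applied to a vector is the inner product with the
gradient `heatKernelGrad`. [folklore] -/
theorem fderiv_heatKernel_apply (t : ℝ) (w v : E) :
    fderiv ℝ (heatKernel t) w v = ⟪heatKernelGrad t w, v⟫ := by
  haveI : CompleteSpace E := FiniteDimensional.complete ℝ E
  rw [(hasGradientAt_heatKernel t w).hasFDerivAt.fderiv, InnerProductSpace.toDual_apply_apply]

omit [MeasurableSpace E] [BorelSpace E] in
/-- `‖fderiv (heatKernel t) w‖ = ‖heatKernelGrad t w‖`. [folklore] -/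
theorem norm_fderiv_heatKernel_eq (t : ℝ) (w : E) :
    ‖fderiv ℝ (heatKernel t) w‖ = ‖heatKernelGrad t w‖ := by
  haveI : CompleteSpace E := FiniteDimensional.complete ℝ E
  rw [(hasGradientAt_heatKernel t w).hasFDerivAt.fderiv]
  simp

/-- The gradient of the heat kernel is integrable for `t > 0`
(from `Literature.Analysis.UnboundedOperators.lintegral_enorm_fderiv_heatKernel_le`). [folklore] -/
theorem integrable_fderiv_heatKernel {t : ℝ} (ht : 0 < t) :
    Integrable (fderiv ℝ (heatKernel (E := E) t)) := by
  refine ⟨(Literature.Analysis.UnboundedOperators.continuous_fderiv_heatKernel t).aestronglyMeasurable, ?_⟩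
  rw [hasFiniteIntegral_iff_enorm]
  exact (Literature.Analysis.UnboundedOperators.lintegral_enorm_fderiv_heatKernel_le (E := E) ht).trans_lt ENNReal.ofReal_lt_top

omit [MeasurableSpace E] [BorelSpace E] in
/-- The gradient of the heat kernel is bounded for `t > 0` (from `Literature.Analysis.UnboundedOperators.norm_fderiv_heatKernel_le`). [folklore] -/
theorem norm_heatKernelGrad_le_const {t : ℝ} (ht : 0 < t) (w : E) :
    ‖heatKernelGrad t w‖ ≤ (4 * Real.pi * t) ^ (-(Module.finrank ℝ E : ℝ) / 2) * (Real.sqrt t)⁻¹ := by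
  rw [← norm_fderiv_heatKernel_eq]
  refine (Literature.Analysis.UnboundedOperators.norm_fderiv_heatKernel_le ht w).trans ?_
  have h1 : Real.exp (-(1 / (8 * t)) * ‖w‖ ^ 2) ≤ 1 := by
    rw [Real.exp_le_one_iff]
    have : 0 ≤ 1 / (8 * t) * ‖w‖ ^ 2 := by positivity
    linarith
  have h0 : 0 ≤ (4 * Real.pi * t) ^ (-(Module.finrank ℝ E : ℝ) / 2) * (Real.sqrt t)⁻¹ := by positivity
  calc (4 * Real.pi * t) ^ (-(Module.finrank ℝ E : ℝ) / 2) * (Real.sqrt t)⁻¹ *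
        Real.exp (-(1 / (8 * t)) * ‖w‖ ^ 2)
      ≤ (4 * Real.pi * t) ^ (-(Module.finrank ℝ E : ℝ) / 2) * (Real.sqrt t)⁻¹ * 1 := by gcongr
    _ = _ := mul_one _

/-! ### The complexified heat kernel and its Fourier transform -/

omit [MeasurableSpace E] [BorelSpace E] in
/-- The complexified heat kernel is differentiable, with derivative the complexification of
`fderiv (heatKernel t)`. [folklore] -/
theorem hasFDerivAt_ofReal_heatKernel (t : ℝ) (w : E) :
    HasFDerivAt (fun w : E => (heatKernel t w : ℂ))
      (Complex.ofRealCLM.comp (fderiv ℝ (heatKernel t) w)) w := by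
  haveI : CompleteSpace E := FiniteDimensional.complete ℝ E
  exact Complex.ofRealCLM.hasFDerivAt.comp w
    (hasGradientAt_heatKernel t w).hasFDerivAt.differentiableAt.hasFDerivAt

omit [MeasurableSpace E] [BorelSpace E] in
/-- `fderiv` of the complexified heat kernel. [folklore] -/
theorem fderiv_ofReal_heatKernel (t : ℝ) :
    fderiv ℝ (fun w : E => (heatKernel t w : ℂ)) =
      fun w => Complex.ofRealCLM.comp (fderiv ℝ (heatKernel t) w) :=
  funext fun w => (hasFDerivAt_ofReal_heatKernel t w).fderiv

/-- The complexified heat kernel is integrable for `t > 0`. [folklore] -/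
theorem integrable_ofReal_heatKernel {t : ℝ} (ht : 0 < t) :
    Integrable (fun w : E => (heatKernel t w : ℂ)) := by
  have h : Integrable (heatKernel (E := E) t) := Literature.Analysis.UnboundedOperators.integrable_heatKernel_holds ht
  exact h.ofReal

/-- The derivative of the complexified heat kernel is integrable for `t > 0`. [folklore] -/
theorem integrable_fderiv_ofReal_heatKernel {t : ℝ} (ht : 0 < t) :
    Integrable (fderiv ℝ (fun w : E => (heatKernel t w : ℂ))) := by
  rw [fderiv_ofReal_heatKernel]
  refine (integrable_fderiv_heatKernel ht).norm.mono' ?_ (Eventually.of_forall fun w => ?_)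
  · exact (continuous_const.clm_comp (Literature.Analysis.UnboundedOperators.continuous_fderiv_heatKernel t)).aestronglyMeasurable
  · refine ContinuousLinearMap.opNorm_le_bound _ (norm_nonneg _) fun v => ?_
    rw [ContinuousLinearMap.comp_apply, Complex.ofRealCLM_apply, Complex.norm_real]
    exact ContinuousLinearMap.le_opNorm _ _

/-- **Fourier transform of the heat kernel**: `𝓕 K_t (ξ) = e^{-4π² t ‖ξ‖²}` (Mathlib's
convention `𝓕 f (ξ) = ∫ e^{-2πi⟨v,ξ⟩} f(v) dv`; Stein–Weiss, *Fourier Analysis on Euclidean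
Spaces*, Ch. I Thm. 1.13). [folklore] -/
theorem fourier_ofReal_heatKernel {t : ℝ} (ht : 0 < t) (ξ : E) :
    𝓕 (fun w : E => (heatKernel t w : ℂ)) ξ =
      (Real.exp (-(4 * Real.pi ^ 2 * t * ‖ξ‖ ^ 2)) : ℂ) := by
  set b : ℂ := ((1 / (4 * t) : ℝ) : ℂ) with hb
  have hbre : 0 < b.re := by rw [hb, Complex.ofReal_re]; positivity
  set c : ℝ := (4 * Real.pi * t) ^ (-(Module.finrank ℝ E : ℝ) / 2) with hc
  have hK : (fun w : E => (heatKernel t w : ℂ)) = fun w => (c : ℂ) * Complex.exp (-b * (‖w‖ : ℂ) ^ 2) := by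
    funext w
    rw [heatKernel, ← hc, Complex.ofReal_mul, Complex.ofReal_exp, hb]
    congr 2
    push_cast
    field_simp
  rw [hK]
  have h1 : 𝓕 (fun w : E => (c : ℂ) * Complex.exp (-b * (‖w‖ : ℂ) ^ 2)) ξ =
      (c : ℂ) * 𝓕 (fun w : E => Complex.exp (-b * (‖w‖ : ℂ) ^ 2)) ξ := by
    simp only [Real.fourier_eq, Circle.smul_def, smul_eq_mul]
    rw [← integral_const_mul]
    congr 1
    funext v
    ring
  rw [h1, fourier_gaussian_innerProductSpace hbre]
  -- constants: `c (π/b)^{d/2} = 1`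
  have h2 : (c : ℂ) * ((Real.pi : ℂ) / b) ^ ((Module.finrank ℝ E : ℂ) / 2) = 1 := by
    have hπb : (Real.pi : ℂ) / b = ((4 * Real.pi * t : ℝ) : ℂ) := by
      rw [hb, ← Complex.ofReal_div]
      congr 1
      field_simp
    have hexp : ((Module.finrank ℝ E : ℂ) / 2) = (((Module.finrank ℝ E : ℝ) / 2 : ℝ) : ℂ) := by
      push_cast; ring
    rw [hπb, hexp, ← Complex.ofReal_cpow (by positivity), ← Complex.ofReal_mul, hc,
      ← Real.rpow_add (by positivity), show -(Module.finrank ℝ E : ℝ) / 2 +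
        (Module.finrank ℝ E : ℝ) / 2 = 0 by ring, Real.rpow_zero, Complex.ofReal_one]
  have h3 : Complex.exp (-(Real.pi : ℂ) ^ 2 * (‖ξ‖ : ℂ) ^ 2 / b) =
      (Real.exp (-(4 * Real.pi ^ 2 * t * ‖ξ‖ ^ 2)) : ℂ) := by
    rw [Complex.ofReal_exp, hb]
    congr 1
    have ht0 : ((4 * t : ℝ) : ℂ) ≠ 0 := by exact_mod_cast (by positivity : (4 * t : ℝ) ≠ 0)
    push_cast at ht0 ⊢
    field_simp
  rw [← mul_assoc, h2, one_mul, h3]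

omit [MeasurableSpace E] [BorelSpace E] in
/-- The complexified directional derivative `∂_v K_t = ⟪∇K_t, v⟫` is `w ↦ fderiv (↑K_t) w v`. [folklore] -/
theorem ofReal_inner_heatKernelGrad_eq (t : ℝ) (w v : E) :
    ((⟪heatKernelGrad t w, v⟫ : ℝ) : ℂ) = fderiv ℝ (fun w : E => (heatKernel t w : ℂ)) w v := by
  rw [fderiv_ofReal_heatKernel]
  simp only [ContinuousLinearMap.comp_apply, Complex.ofRealCLM_apply, fderiv_heatKernel_apply]

/-- `∂_v K_t` is integrable for `t > 0`. [folklore] -/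
theorem integrable_inner_heatKernelGrad {t : ℝ} (ht : 0 < t) (v : E) :
    Integrable (fun w : E => ⟪heatKernelGrad t w, v⟫) :=
  ((integrable_fderiv_heatKernel ht).apply_continuousLinearMap v).congr
    (Eventually.of_forall fun w => fderiv_heatKernel_apply t w v)

/-- The complexified `∂_v K_t` is integrable for `t > 0`. [folklore] -/
theorem integrable_ofReal_inner_heatKernelGrad {t : ℝ} (ht : 0 < t) (v : E) :
    Integrable (fun w : E => ((⟪heatKernelGrad t w, v⟫ : ℝ) : ℂ)) :=
  (integrable_inner_heatKernelGrad ht v).ofReal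

/-- **Fourier transform of `∂_v K_t`**: `𝓕(∂_v K_t)(ξ) = 2πi ⟪ξ, v⟫ e^{-4π² t ‖ξ‖²}`
(from `Real.fourier_fderiv` and `fourier_ofReal_heatKernel`). [folklore] -/
theorem fourier_ofReal_inner_heatKernelGrad {t : ℝ} (ht : 0 < t) (v ξ : E) :
    𝓕 (fun w : E => ((⟪heatKernelGrad t w, v⟫ : ℝ) : ℂ)) ξ =
      (2 * Real.pi * Complex.I * (⟪ξ, v⟫ : ℝ)) * (Real.exp (-(4 * Real.pi ^ 2 * t * ‖ξ‖ ^ 2)) : ℂ) := by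
  have h1 : (fun w : E => ((⟪heatKernelGrad t w, v⟫ : ℝ) : ℂ)) =
      fun w => fderiv ℝ (fun w : E => (heatKernel t w : ℂ)) w v :=
    funext fun w => ofReal_inner_heatKernelGrad_eq t w v
  have hdiff : Differentiable ℝ (fun w : E => (heatKernel t w : ℂ)) :=
    fun w => (hasFDerivAt_ofReal_heatKernel t w).differentiableAt
  rw [h1, ← Real.fourier_continuousLinearMap_apply (integrable_fderiv_ofReal_heatKernel ht),
    Real.fourier_fderiv (integrable_ofReal_heatKernel ht) hdiff (integrable_fderiv_ofReal_heatKernel ht),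
    VectorFourier.fourierSMulRight_apply, fourier_ofReal_heatKernel ht]
  simp only [neg_apply, innerSL_apply_apply ℝ, smul_eq_mul, neg_mul, neg_smul,
    Complex.real_smul]
  ring

/-- `|𝓕(∂_v K_t)(ξ)|² = 4π² ⟪ξ, v⟫² e^{-8π² t ‖ξ‖²}`. [folklore] -/
theorem norm_fourier_ofReal_inner_heatKernelGrad_sq {t : ℝ} (ht : 0 < t) (v ξ : E) :
    ‖𝓕 (fun w : E => ((⟪heatKernelGrad t w, v⟫ : ℝ) : ℂ)) ξ‖ ^ 2 =
      4 * Real.pi ^ 2 * ⟪ξ, v⟫ ^ 2 * Real.exp (-(8 * Real.pi ^ 2 * t * ‖ξ‖ ^ 2)) := by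
  rw [fourier_ofReal_inner_heatKernelGrad ht, norm_mul, Complex.norm_real, Real.norm_of_nonneg
    (Real.exp_nonneg _)]
  have h1 : ‖(2 * Real.pi * Complex.I * (⟪ξ, v⟫ : ℝ) : ℂ)‖ = 2 * Real.pi * |⟪ξ, v⟫| := by
    simp [abs_of_pos Real.pi_pos]
  rw [h1, mul_pow, show (Real.exp (-(4 * Real.pi ^ 2 * t * ‖ξ‖ ^ 2))) ^ 2 =
    Real.exp (-(8 * Real.pi ^ 2 * t * ‖ξ‖ ^ 2)) by rw [← Real.exp_nat_mul]; congr 1; push_cast; ring]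
  rw [mul_pow, mul_pow, sq_abs]
  ring

end KernelFourier

/-! ### The energy identity for the caloric extension of an `L¹ ∩ L²` function -/

section Energy

variable {E : Type*} [NormedAddCommGroup E] [InnerProductSpace ℝ E] [FiniteDimensional ℝ E]
  [MeasurableSpace E] [BorelSpace E]

/-- For `g ∈ L¹`, the integrand `z ↦ g(z) ∇K_t(y - z)` of `heatExtensionGrad g t y` is integrable
(`∇K_t` is bounded). [folklore] -/
theorem integrable_smul_heatKernelGrad_sub {g : E → ℝ} (hg : Integrable g) {t : ℝ} (ht : 0 < t)
    (y : E) : Integrable fun z => g z • heatKernelGrad t (y - z) := by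
  have hcont : Continuous fun z : E => heatKernelGrad t (y - z) := by
    unfold heatKernelGrad heatKernel
    fun_prop
  have hf : MemLp (fun z : E => heatKernelGrad t (y - z)) ∞ volume :=
    memLp_top_of_bound hcont.aestronglyMeasurable _
      (Eventually.of_forall fun z => norm_heatKernelGrad_le_const ht (y - z))
  have := hg.smul_of_top_left hf
  exact this

/-- The components of `∇e^{tΔ}g` are convolutions: `⟪∇e^{tΔ}g (y), v⟫ = (g ⋆ ∂_v K_t)(y)`. [folklore] -/
theorem inner_heatExtensionGrad_eq_convolution {g : E → ℝ} (hg : Integrable g) {t : ℝ} (ht : 0 < t)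
    (v y : E) :
    ⟪heatExtensionGrad g t y, v⟫ =
      (g ⋆[ContinuousLinearMap.lsmul ℝ ℝ, volume] fun w => ⟪heatKernelGrad t w, v⟫) y := by
  haveI : CompleteSpace E := FiniteDimensional.complete ℝ E
  rw [convolution_def, heatExtensionGrad, real_inner_comm,
    ← integral_inner (integrable_smul_heatKernelGrad_sub hg ht y) v]
  congr 1
  funext z
  rw [ContinuousLinearMap.lsmul_apply, smul_eq_mul, real_inner_smul_right, real_inner_comm]

/-- `lsmul ℝ ℝ` is symmetric. [folklore] -/
theorem lsmul_flip :
    (ContinuousLinearMap.lsmul ℝ ℝ : ℝ →L[ℝ] ℝ →L[ℝ] ℝ).flip = ContinuousLinearMap.lsmul ℝ ℝ := by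
  ext
  simp

/-- Young: for `g ∈ L²`, `g ⋆ ∂_v K_t ∈ L²`. [folklore] -/
theorem memLp_two_convolution_inner_heatKernelGrad {g : E → ℝ} (hg2 : MemLp g 2) {t : ℝ}
    (ht : 0 < t) (v : E) :
    MemLp (g ⋆[ContinuousLinearMap.lsmul ℝ ℝ, volume] fun w => ⟪heatKernelGrad t w, v⟫) 2 volume := by
  rw [← convolution_flip, lsmul_flip]
  exact Literature.Analysis.UnboundedOperators.memLp_convolution_lsmul (integrable_inner_heatKernelGrad ht v) hg2 one_le_two

/-- Complexification of the convolution `g ⋆ ∂_v K_t`. [folklore] -/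
theorem ofReal_convolution_inner_heatKernelGrad {g : E → ℝ} (t : ℝ) (v y : E) :
    (((g ⋆[ContinuousLinearMap.lsmul ℝ ℝ, volume] fun w => ⟪heatKernelGrad t w, v⟫) y : ℝ) : ℂ) =
      ((fun z => (g z : ℂ)) ⋆[ContinuousLinearMap.mul ℂ ℂ, volume]
        fun w => ((⟪heatKernelGrad t w, v⟫ : ℝ) : ℂ)) y := by
  rw [convolution_def, convolution_def, ← integral_complex_ofReal]
  congr 1
  funext z
  simp only [ContinuousLinearMap.lsmul_apply, smul_eq_mul, Complex.ofReal_mul,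
    ContinuousLinearMap.mul_apply']

/-- `‖(x : ℂ)‖ₑ = ‖x‖ₑ` for real `x`. [folklore] -/
theorem enorm_ofReal_complex (x : ℝ) : ‖(x : ℂ)‖ₑ = ‖x‖ₑ := by
  rw [← ofReal_norm, Complex.norm_real, ofReal_norm]

/-- **Plancherel for one component of `∇e^{tΔ}g`**: for `g ∈ L¹ ∩ L²` and `t > 0`,
`∫ |⟪∇e^{tΔ}g, v⟫|² dy = ∫ |ĝ(ξ)|² 4π²⟪ξ,v⟫² e^{-8π²t‖ξ‖²} dξ`. [folklore] -/
theorem lintegral_enorm_inner_heatExtensionGrad_sq {g : E → ℝ} (hg1 : Integrable g) (hg2 : MemLp g 2)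
    {t : ℝ} (ht : 0 < t) (v : E) :
    ∫⁻ y, ‖⟪heatExtensionGrad g t y, v⟫‖ₑ ^ 2 =
      ∫⁻ ξ, ‖𝓕 (fun z => (g z : ℂ)) ξ‖ₑ ^ 2 *
        ENNReal.ofReal (4 * Real.pi ^ 2 * ⟪ξ, v⟫ ^ 2 * Real.exp (-(8 * Real.pi ^ 2 * t * ‖ξ‖ ^ 2))) := by
  set R : E → ℂ := (fun z => (g z : ℂ)) ⋆[ContinuousLinearMap.mul ℂ ℂ, volume]
    fun w => ((⟪heatKernelGrad t w, v⟫ : ℝ) : ℂ) with hR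
  have hG : Integrable (fun z => (g z : ℂ)) := hg1.ofReal
  have hK : Integrable (fun w : E => ((⟪heatKernelGrad t w, v⟫ : ℝ) : ℂ)) :=
    integrable_ofReal_inner_heatKernelGrad ht v
  have hR_eq : ∀ y, ((⟪heatExtensionGrad g t y, v⟫ : ℝ) : ℂ) = R y := fun y => by
    rw [inner_heatExtensionGrad_eq_convolution hg1 ht v y, ofReal_convolution_inner_heatKernelGrad]
  have hR1 : Integrable R := hG.integrable_convolution _ hK
  have hR2 : MemLp R 2 volume := by
    refine (memLp_two_convolution_inner_heatKernelGrad hg2 ht v).of_le hR1.aestronglyMeasurable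
      (Eventually.of_forall fun y => le_of_eq ?_)
    rw [← hR_eq, Complex.norm_real, inner_heatExtensionGrad_eq_convolution hg1 ht v y]
  have h1 : ∫⁻ y, ‖⟪heatExtensionGrad g t y, v⟫‖ₑ ^ 2 = ∫⁻ y, ‖R y‖ₑ ^ 2 :=
    lintegral_congr fun y => by rw [← hR_eq, enorm_ofReal_complex]
  rw [h1, ← Literature.Analysis.FunctionSpaces.lintegral_enorm_sq_fourierIntegral_eq hR1 hR2]
  refine lintegral_congr fun ξ => ?_
  rw [hR, Real.fourier_mul_convolution_eq hG hK ξ, enorm_mul, mul_pow]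
  congr 1
  rw [← ofReal_norm, ← ENNReal.ofReal_pow (norm_nonneg _),
    norm_fourier_ofReal_inner_heatKernelGrad_sq ht]

/-- **Plancherel for `∇e^{tΔ}g`**: for `g ∈ L¹ ∩ L²` and `t > 0`,
`∫ ‖∇e^{tΔ}g‖² dy = ∫ |ĝ(ξ)|² 4π²‖ξ‖² e^{-8π²t‖ξ‖²} dξ`. [folklore] -/
theorem lintegral_enorm_heatExtensionGrad_sq {g : E → ℝ} (hg1 : Integrable g) (hg2 : MemLp g 2)
    {t : ℝ} (ht : 0 < t) :
    ∫⁻ y, ‖heatExtensionGrad g t y‖ₑ ^ 2 =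
      ∫⁻ ξ, ‖𝓕 (fun z => (g z : ℂ)) ξ‖ₑ ^ 2 *
        ENNReal.ofReal (4 * Real.pi ^ 2 * ‖ξ‖ ^ 2 * Real.exp (-(8 * Real.pi ^ 2 * t * ‖ξ‖ ^ 2))) := by
  set b := stdOrthonormalBasis ℝ E with hb
  -- expand `‖G‖²` in the orthonormal basis
  have hsq : ∀ y, ‖heatExtensionGrad g t y‖ₑ ^ 2 = ∑ i, ‖⟪heatExtensionGrad g t y, b i⟫‖ₑ ^ 2 := by
    intro y
    rw [← ofReal_norm, ← ENNReal.ofReal_pow (norm_nonneg _), ← b.sum_sq_inner_right,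
      ENNReal.ofReal_sum_of_nonneg fun i _ => sq_nonneg _]
    refine Finset.sum_congr rfl fun i _ => ?_
    rw [← ofReal_norm, ← ENNReal.ofReal_pow (norm_nonneg _), Real.norm_eq_abs, sq_abs,
      real_inner_comm]
  simp_rw [hsq]
  rw [lintegral_finsetSum' _ fun i _ => ?_]
  · simp_rw [lintegral_enorm_inner_heatExtensionGrad_sq hg1 hg2 ht]
    rw [← lintegral_finsetSum' _ fun i _ => ?_]
    · refine lintegral_congr fun ξ => ?_
      rw [← Finset.mul_sum, ← ENNReal.ofReal_sum_of_nonneg fun i _ => by positivity]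
      congr 2
      rw [← Finset.sum_mul, ← Finset.mul_sum]
      congr 2
      rw [← b.sum_sq_inner_right ξ]
      exact Finset.sum_congr rfl fun i _ => by rw [real_inner_comm]
    · exact ((Literature.Analysis.FunctionSpaces.continuous_fourierIntegral (hg1.ofReal : Integrable (fun z => (g z : ℂ)))).measurable.enorm.pow_const _).aemeasurable.mul
        (Measurable.ennreal_ofReal (by fun_prop)).aemeasurable
  · have hm : Measurable fun y => heatExtensionGrad g t y :=
      (measurable_heatExtensionGrad hg1.aestronglyMeasurable).comp (measurable_const.prodMk measurable_id)
    exact ((hm.inner measurable_const).enorm.pow_const _).aemeasurable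

omit [InnerProductSpace ℝ E] [FiniteDimensional ℝ E] [MeasurableSpace E] [BorelSpace E] in
/-- The time integral of the symbol: `∫₀^∞ 4π²‖ξ‖² e^{-8π²t‖ξ‖²} dt ≤ 1/2` (with equality for
`ξ ≠ 0`). [folklore] -/
theorem lintegral_Ioi_symbol_le (ξ : E) :
    ∫⁻ t in Set.Ioi (0 : ℝ), ENNReal.ofReal (4 * Real.pi ^ 2 * ‖ξ‖ ^ 2 *
        Real.exp (-(8 * Real.pi ^ 2 * t * ‖ξ‖ ^ 2))) ≤ ENNReal.ofReal (1 / 2) := by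
  rcases eq_or_ne ξ 0 with rfl | hξ
  · simp
  · have hξ' : 0 < ‖ξ‖ := norm_pos_iff.mpr hξ
    have ha : 0 < 8 * Real.pi ^ 2 * ‖ξ‖ ^ 2 := by positivity
    have hint : IntegrableOn (fun t : ℝ => 4 * Real.pi ^ 2 * ‖ξ‖ ^ 2 *
        Real.exp (-(8 * Real.pi ^ 2 * t * ‖ξ‖ ^ 2))) (Set.Ioi 0) := by
      have h0 : IntegrableOn (fun t : ℝ => 4 * Real.pi ^ 2 * ‖ξ‖ ^ 2 *
          Real.exp (-(8 * Real.pi ^ 2 * ‖ξ‖ ^ 2) * t)) (Set.Ioi 0) :=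
        (exp_neg_integrableOn_Ioi 0 ha).const_mul (4 * Real.pi ^ 2 * ‖ξ‖ ^ 2)
      refine h0.congr_fun (fun t _ => ?_) measurableSet_Ioi
      simp only
      congr 2
      ring
    rw [← ofReal_integral_eq_lintegral_ofReal hint]
    · refine ENNReal.ofReal_le_ofReal (le_of_eq ?_)
      have e1 : (fun t : ℝ => 4 * Real.pi ^ 2 * ‖ξ‖ ^ 2 * Real.exp (-(8 * Real.pi ^ 2 * t * ‖ξ‖ ^ 2))) =
          fun t : ℝ => 4 * Real.pi ^ 2 * ‖ξ‖ ^ 2 * Real.exp (-(8 * Real.pi ^ 2 * ‖ξ‖ ^ 2) * t) := by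
        funext t; congr 2; ring
      rw [e1, integral_const_mul, integral_exp_mul_Ioi (by linarith) 0]
      field_simp
      simp
      ring
    · filter_upwards with t
      positivity

/-- **The energy inequality for the caloric extension** (Grafakos, *Modern Fourier Analysis*,
3rd ed., proof of Theorem 3.3.8 (b), the `L²` step via Plancherel; classical:
`∫₀^∞ ∫ |∇e^{tΔ}g|² dy dt = ½‖g‖²₂ - lim ½‖e^{tΔ}g‖²₂ ≤ ½‖g‖²₂`): for `g ∈ L¹ ∩ L²(E)`,
`∫₀^∞ ∫_E ‖∇e^{tΔ}g (y)‖² dy dt ≤ ½ ∫ |g|²` (proof: Plancherel in `y` for each `t`, Tonelli, and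
`∫₀^∞ 4π²|ξ|² e^{-8π²t|ξ|²} dt = ½`). [folklore] -/
theorem lintegral_Ioi_lintegral_enorm_heatExtensionGrad_sq_le {g : E → ℝ} (hg1 : Integrable g)
    (hg2 : MemLp g 2) :
    ∫⁻ t in Set.Ioi (0 : ℝ), ∫⁻ y, ‖heatExtensionGrad g t y‖ₑ ^ 2 ≤
      ENNReal.ofReal (1 / 2) * ∫⁻ y, ‖g y‖ₑ ^ 2 := by
  have hG : Integrable (fun z => (g z : ℂ)) := hg1.ofReal
  have hG2 : MemLp (fun z => (g z : ℂ)) 2 volume :=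
    MemLp.of_le hg2 hG.aestronglyMeasurable (Eventually.of_forall fun z => by
      rw [Complex.norm_real])
  have hFc : Continuous (𝓕 (fun z => (g z : ℂ))) := Literature.Analysis.FunctionSpaces.continuous_fourierIntegral hG
  have step1 : ∫⁻ t in Set.Ioi (0 : ℝ), ∫⁻ y, ‖heatExtensionGrad g t y‖ₑ ^ 2 =
      ∫⁻ t in Set.Ioi (0 : ℝ), ∫⁻ ξ, ‖𝓕 (fun z => (g z : ℂ)) ξ‖ₑ ^ 2 *
        ENNReal.ofReal (4 * Real.pi ^ 2 * ‖ξ‖ ^ 2 * Real.exp (-(8 * Real.pi ^ 2 * t * ‖ξ‖ ^ 2))) :=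
    setLIntegral_congr_fun measurableSet_Ioi fun t ht =>
      lintegral_enorm_heatExtensionGrad_sq hg1 hg2 ht
  have hmeas : Measurable fun p : ℝ × E => ‖𝓕 (fun z => (g z : ℂ)) p.2‖ₑ ^ 2 *
      ENNReal.ofReal (4 * Real.pi ^ 2 * ‖p.2‖ ^ 2 * Real.exp (-(8 * Real.pi ^ 2 * p.1 * ‖p.2‖ ^ 2))) :=
    ((hFc.measurable.comp measurable_snd).enorm.pow_const _).mul
      (Measurable.ennreal_ofReal (by fun_prop))
  have step2 : ∫⁻ t in Set.Ioi (0 : ℝ), ∫⁻ ξ, ‖𝓕 (fun z => (g z : ℂ)) ξ‖ₑ ^ 2 *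
        ENNReal.ofReal (4 * Real.pi ^ 2 * ‖ξ‖ ^ 2 * Real.exp (-(8 * Real.pi ^ 2 * t * ‖ξ‖ ^ 2))) =
      ∫⁻ ξ, ∫⁻ t in Set.Ioi (0 : ℝ), ‖𝓕 (fun z => (g z : ℂ)) ξ‖ₑ ^ 2 *
        ENNReal.ofReal (4 * Real.pi ^ 2 * ‖ξ‖ ^ 2 * Real.exp (-(8 * Real.pi ^ 2 * t * ‖ξ‖ ^ 2))) :=
    lintegral_lintegral_swap hmeas.aemeasurable
  have step3 : ∀ ξ : E, ∫⁻ t in Set.Ioi (0 : ℝ), ‖𝓕 (fun z => (g z : ℂ)) ξ‖ₑ ^ 2 *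
        ENNReal.ofReal (4 * Real.pi ^ 2 * ‖ξ‖ ^ 2 * Real.exp (-(8 * Real.pi ^ 2 * t * ‖ξ‖ ^ 2))) ≤
      ‖𝓕 (fun z => (g z : ℂ)) ξ‖ₑ ^ 2 * ENNReal.ofReal (1 / 2) := by
    intro ξ
    rw [lintegral_const_mul _ (Measurable.ennreal_ofReal (by fun_prop))]
    gcongr
    exact lintegral_Ioi_symbol_le ξ
  have step4 : ∫⁻ ξ, ‖𝓕 (fun z => (g z : ℂ)) ξ‖ₑ ^ 2 * ENNReal.ofReal (1 / 2) =
      ENNReal.ofReal (1 / 2) * ∫⁻ y, ‖g y‖ₑ ^ 2 := by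
    rw [lintegral_mul_const _ (hFc.measurable.enorm.pow_const _), mul_comm,
      Literature.Analysis.FunctionSpaces.lintegral_enorm_sq_fourierIntegral_eq hG hG2]
    congr 1
    exact lintegral_congr fun y => by rw [enorm_ofReal_complex]
  rw [step1, step2, ← step4]
  exact lintegral_mono step3

end Energy

end BMOInv



namespace BMOInv

section Decomposition

variable {E : Type*} [NormedAddCommGroup E] [InnerProductSpace ℝ E] [FiniteDimensional ℝ E]
  [MeasurableSpace E] [BorelSpace E]

omit [FiniteDimensional ℝ E] [MeasurableSpace E] [BorelSpace E] in
/-- The gradient of the heat kernel is odd. [folklore] -/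
theorem heatKernelGrad_neg (t : ℝ) (w : E) : heatKernelGrad t (-w) = -heatKernelGrad t w := by
  simp [heatKernelGrad, heatKernel, norm_neg, smul_neg]

/-- The gradient of the heat kernel is integrable for `t > 0`. [folklore] -/
theorem integrable_heatKernelGrad {t : ℝ} (ht : 0 < t) : Integrable (heatKernelGrad (E := E) t) := by
  refine (integrable_fderiv_heatKernel ht).norm.mono' ?_ (Eventually.of_forall fun w => ?_)
  · have : Continuous (heatKernelGrad (E := E) t) := by
      unfold heatKernelGrad heatKernel
      fun_prop
    exact this.aestronglyMeasurable
  · rw [norm_fderiv_heatKernel_eq]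

/-- `∫ ∇K_t = 0` (oddness; no integrability needed). [folklore] -/
theorem integral_heatKernelGrad (t : ℝ) : ∫ w, heatKernelGrad t w = (0 : E) := by
  have h : ∫ w : E, heatKernelGrad t w = -∫ w : E, heatKernelGrad t w := by
    calc ∫ w : E, heatKernelGrad t w = ∫ w : E, heatKernelGrad t (-w) :=
          (integral_neg_eq_self _ _).symm
      _ = ∫ w : E, -heatKernelGrad t w := by simp_rw [heatKernelGrad_neg]
      _ = -∫ w : E, heatKernelGrad t w := integral_neg _
  have h2 : (2 : ℝ) • ∫ w : E, heatKernelGrad t w = 0 := by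
    rw [two_smul]
    nth_rewrite 2 [h]
    exact add_neg_cancel _
  rcases smul_eq_zero.mp h2 with h3 | h3
  · norm_num at h3
  · exact h3

/-- `∫ ∇K_t(y - z) dz = 0`. [folklore] -/
theorem integral_heatKernelGrad_sub (t : ℝ) (y : E) : ∫ z, heatKernelGrad t (y - z) = (0 : E) := by
  rw [integral_sub_left_eq_self (heatKernelGrad t) volume y]
  exact integral_heatKernelGrad t

/-- The gradient of the caloric extension kills constants: `∇e^{tΔ} c = 0`. [folklore] -/
theorem heatExtensionGrad_const (c : ℝ) (t : ℝ) (y : E) :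
    heatExtensionGrad (fun _ : E => c) t y = 0 := by
  simp [heatExtensionGrad, integral_smul, integral_heatKernelGrad_sub]

/-- Additivity of `∇e^{tΔ}` under integrability of the two integrands. [folklore] -/
theorem heatExtensionGrad_add {f g : E → ℝ} {t : ℝ} {y : E}
    (hf : Integrable fun z => f z • heatKernelGrad t (y - z))
    (hg : Integrable fun z => g z • heatKernelGrad t (y - z)) :
    heatExtensionGrad (f + g) t y = heatExtensionGrad f t y + heatExtensionGrad g t y := by
  simp only [heatExtensionGrad, Pi.add_apply, add_smul]
  exact integral_add hf hg

/-- The polynomial weight `(1 + ‖z‖)^{-(d+1)}` is integrable on `E` (`d = dim E`). [folklore] -/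
theorem integrable_inv_one_add_norm_pow :
    Integrable fun z : E => ((1 + ‖z‖) ^ (Module.finrank ℝ E + 1))⁻¹ := by
  have h := integrable_one_add_norm (E := E) (μ := volume) (r := (Module.finrank ℝ E + 1 : ℕ))
    (by push_cast; linarith)
  refine h.congr (Eventually.of_forall fun z => ?_)
  simp only
  rw [Real.rpow_neg (by positivity), Real.rpow_natCast]

/-- For `f ∈ BMO`, a constant `c`, `t > 0` and `y`, the function `z ↦ (f(z) - c) ∇K_t(y - z)` is
integrable (growth of `BMO` functions, fact (A), against the Gaussian decay of `∇K_t`). [folklore] -/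
theorem _root_.Literature.Analysis.FunctionSpaces.MemBMO.integrable_sub_const_smul_heatKernelGrad {f : E → ℝ} (hf : MemBMO f)
    (c : ℝ) {t : ℝ} (ht : 0 < t) (y : E) :
    Integrable fun z => (f z - c) • heatKernelGrad t (y - z) := by
  set d := Module.finrank ℝ E with hd
  have hw : Integrable fun z => ((1 + ‖z‖) ^ (d + 1))⁻¹ * (f z - c) := by
    have h1 := hf.integrable_one_add_norm_pow_inv_mul
    have h2 := (integrable_inv_one_add_norm_pow (E := E)).mul_const c
    refine (h1.sub h2).congr (Eventually.of_forall fun z => ?_)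
    simp only [Pi.sub_apply, hd]
    ring
  have hwn : Integrable fun z => ((1 + ‖z‖) ^ (d + 1))⁻¹ * |f z - c| := by
    refine hw.norm.congr (Eventually.of_forall fun z => ?_)
    simp only
    rw [norm_mul, Real.norm_of_nonneg (by positivity), Real.norm_eq_abs]
  obtain ⟨C, hC⟩ := exists_bound_one_add_norm_pow_mul_norm_heatKernelGrad ht y (d + 1)
  have hint : Integrable fun z => |f z - c| * ‖heatKernelGrad t (y - z)‖ :=
    integrable_mul_of_weight_bound (w := fun z => (1 + ‖z‖) ^ (d + 1)) (fun z => by positivity)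
      (by fun_prop) hwn (continuous_heatKernelGrad_sub t y).norm (fun z => norm_nonneg _) hC
  refine hint.mono' ?_ (Eventually.of_forall fun z => by rw [norm_smul, Real.norm_eq_abs])
  exact (hf.1.aestronglyMeasurable.sub aestronglyMeasurable_const).smul
    (continuous_heatKernelGrad_sub t y).aestronglyMeasurable

omit [InnerProductSpace ℝ E] [FiniteDimensional ℝ E] [MeasurableSpace E] [BorelSpace E] in
/-- Indicators commute with the scalar action on the kernel. [folklore] -/
theorem indicator_smul_heatKernelGrad_apply [InnerProductSpace ℝ E] (s : Set E) (h : E → ℝ)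
    (t : ℝ) (y z : E) :
    s.indicator h z • heatKernelGrad t (y - z) =
      s.indicator (fun z => h z • heatKernelGrad t (y - z)) z := by
  by_cases hz : z ∈ s <;> simp [hz]

/-- **Near/far decomposition of `∇e^{tΔ}f` for `f ∈ BMO`**: with `B* = B(x, 2R)`, `c = f_{B*}`,
`f₁ = (f - c)1_{B*}`, `f₂ = (f - c)1_{B*ᶜ}`, one has `∇e^{tΔ}f = ∇e^{tΔ}f₁ + ∇e^{tΔ}f₂`
(`f = c + f₁ + f₂` and `∇e^{tΔ}c = 0`; Grafakos, *Modern Fourier Analysis*, 3rd ed., proof of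
Theorem 3.3.8 (b), the splitting `f = c + (f - c)χ + (f - c)(1 - χ)`). [folklore] -/
theorem heatExtensionGrad_eq_near_add_far {f : E → ℝ} (hf : MemBMO f) (x : E) (ρ : ℝ) {t : ℝ}
    (ht : 0 < t) (y : E) :
    heatExtensionGrad f t y =
      heatExtensionGrad ((ball x ρ).indicator fun z => f z - ⨍ w in ball x ρ, f w) t y +
      heatExtensionGrad ((ball x ρ)ᶜ.indicator fun z => f z - ⨍ w in ball x ρ, f w) t y := by
  obtain ⟨c, hc⟩ : ∃ c : ℝ, c = ⨍ w in ball x ρ, f w := ⟨_, rfl⟩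
  rw [← hc]
  have H := hf.integrable_sub_const_smul_heatKernelGrad c ht y
  have h1 : Integrable fun z => (ball x ρ).indicator (fun z => f z - c) z • heatKernelGrad t (y - z) := by
    have := H.indicator (measurableSet_ball : MeasurableSet (ball x ρ))
    refine this.congr (Eventually.of_forall fun z => ?_)
    exact (indicator_smul_heatKernelGrad_apply _ _ t y z).symm
  have h2 : Integrable fun z => (ball x ρ)ᶜ.indicator (fun z => f z - c) z • heatKernelGrad t (y - z) := by
    have := H.indicator (measurableSet_ball : MeasurableSet (ball x ρ)).compl
    refine this.congr (Eventually.of_forall fun z => ?_)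
    exact (indicator_smul_heatKernelGrad_apply _ _ t y z).symm
  have h0 : Integrable fun z => (fun _ : E => c) z • heatKernelGrad t (y - z) :=
    ((integrable_heatKernelGrad ht).comp_sub_left y).smul c
  have hdecomp : f = (fun _ : E => c) + (((ball x ρ).indicator fun z => f z - c) +
      (ball x ρ)ᶜ.indicator fun z => f z - c) := by
    funext z
    simp only [Pi.add_apply, Set.indicator_self_add_compl_apply]
    ring
  have h12 : Integrable fun z => (((ball x ρ).indicator fun z => f z - c) +
      (ball x ρ)ᶜ.indicator fun z => f z - c) z • heatKernelGrad t (y - z) := by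
    refine (h1.add h2).congr (Eventually.of_forall fun z => ?_)
    simp only [Pi.add_apply, add_smul]
  conv_lhs => rw [hdecomp]
  rw [heatExtensionGrad_add h0 h12, heatExtensionGrad_add h1 h2, heatExtensionGrad_const, zero_add]

end Decomposition

/-! ## The far part: pointwise bound on `B(x, R)` -/

section Far

variable {E : Type*} [NormedAddCommGroup E] [InnerProductSpace ℝ E] [FiniteDimensional ℝ E]
  [MeasurableSpace E] [BorelSpace E]

omit [InnerProductSpace ℝ E] [FiniteDimensional ℝ E] [MeasurableSpace E] [BorelSpace E] in
/-- Geometry of the near/far split: for `y ∈ B(x, R)` and `z ∉ B(x, 2R)`, `‖z - x‖ ≤ 2‖y - z‖`. [folklore] -/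
theorem norm_sub_le_two_mul_norm_sub {x y z : E} {R : ℝ} (hy : y ∈ ball x R)
    (hz : z ∉ ball x (2 * R)) : ‖z - x‖ ≤ 2 * ‖y - z‖ := by
  rw [mem_ball_iff_norm] at hy
  rw [mem_ball_iff_norm, not_lt] at hz
  have := norm_sub_le_norm_sub_add_norm_sub z y x
  rw [norm_sub_rev z y] at this
  linarith

omit [MeasurableSpace E] [BorelSpace E] in
/-- The kernel bound off the doubled ball: for `y ∈ B(x,R)`, `z ∉ B(x,2R)`, `t > 0`,
`‖∇K_t(y - z)‖ ≤ 2 (d+2)! 2^{d+1} ‖z - x‖^{-(d+1)}`. [folklore] -/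
theorem norm_heatKernelGrad_sub_le_far {t : ℝ} (ht : 0 < t) {x y z : E} {R : ℝ} (hR : 0 < R)
    (hy : y ∈ ball x R) (hz : z ∉ ball x (2 * R)) :
    ‖heatKernelGrad t (y - z)‖ ≤ 2 * (Module.finrank ℝ E + 2).factorial * 2 ^ (Module.finrank ℝ E + 1) *
      (‖z - x‖ ^ (Module.finrank ℝ E + 1))⁻¹ := by
  set d := Module.finrank ℝ E with hd
  have hzx : 0 < ‖z - x‖ := by
    rw [mem_ball_iff_norm, not_lt] at hz
    linarith
  have h1 := norm_pow_mul_norm_heatKernelGrad_le ht (y - z)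
  rw [← hd] at h1
  have h2 : ‖z - x‖ ^ (d + 1) ≤ 2 ^ (d + 1) * ‖y - z‖ ^ (d + 1) := by
    rw [← mul_pow]
    exact pow_le_pow_left₀ (norm_nonneg _) (norm_sub_le_two_mul_norm_sub hy hz) _
  rw [le_mul_inv_iff₀ (by positivity)]
  calc ‖heatKernelGrad t (y - z)‖ * ‖z - x‖ ^ (d + 1)
      ≤ ‖heatKernelGrad t (y - z)‖ * (2 ^ (d + 1) * ‖y - z‖ ^ (d + 1)) := by gcongr
    _ = 2 ^ (d + 1) * (‖y - z‖ ^ (d + 1) * ‖heatKernelGrad t (y - z)‖) := by ring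
    _ ≤ 2 ^ (d + 1) * (2 * (d + 2).factorial) := by gcongr
    _ = 2 * (d + 2).factorial * 2 ^ (d + 1) := by ring

/-- **The far part is uniformly small on `B(x, R)`**: for `f ∈ BMO`, `y ∈ B(x,R)`, `t > 0`, with
`f₂ = (f - f_{B(x,2R)}) 1_{B(x,2R)ᶜ}`,
`‖∇e^{tΔ}f₂ (y)‖ ≤ (d+2)! 2^{d+1} · 2^{d+1}(1 + 2^{d+1}) |B(0,1)| ‖f‖_* / R`
(kernel decay `norm_heatKernelGrad_sub_le_far` and the tail estimate
`MemBMO.lintegral_compl_ball_enorm_sub_average_mul_le`; Grafakos, *Modern Fourier Analysis*,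
3rd ed., proof of Theorem 3.3.8 (b), the term with (3.3.14)). [folklore] -/
theorem enorm_heatExtensionGrad_far_le {f : E → ℝ} (hf : MemBMO f) (x : E) {R : ℝ} (hR : 0 < R)
    {t : ℝ} (ht : 0 < t) {y : E} (hy : y ∈ ball x R) :
    ‖heatExtensionGrad ((ball x (2 * R))ᶜ.indicator fun z => f z - ⨍ w in ball x (2 * R), f w) t y‖ₑ ≤
      ENNReal.ofReal ((Module.finrank ℝ E + 2).factorial * 2 ^ (Module.finrank ℝ E + 1) *
        (2 ^ (Module.finrank ℝ E + 1) * (1 + 2 ^ (Module.finrank ℝ E + 1))) *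
        volume.real (ball (0 : E) 1) * (eBMOSeminorm f).toReal / R) := by
  obtain ⟨d, hd⟩ : ∃ d : ℕ, d = Module.finrank ℝ E := ⟨_, rfl⟩
  obtain ⟨c, hc⟩ : ∃ c : ℝ, c = ⨍ w in ball x (2 * R), f w := ⟨_, rfl⟩
  obtain ⟨S, hS⟩ : ∃ S : ℝ, S = (eBMOSeminorm f).toReal := ⟨_, rfl⟩
  obtain ⟨V, hV⟩ : ∃ V : ℝ, V = volume.real (ball (0 : E) 1) := ⟨_, rfl⟩
  obtain ⟨A, hA⟩ : ∃ A : ℝ, A = 2 * (d + 2).factorial * 2 ^ (d + 1) := ⟨_, rfl⟩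
  rw [← hd, ← hc, ← hS, ← hV]
  have hA0 : 0 ≤ A := hA ▸ by positivity
  have hS0 : 0 ≤ S := hS ▸ ENNReal.toReal_nonneg
  have hV0 : 0 ≤ V := hV ▸ measureReal_nonneg
  have h2R : (0 : ℝ) < 2 * R := by positivity
  -- pointwise bound on the integrand
  have hpt : ∀ z : E, ‖(ball x (2 * R))ᶜ.indicator (fun z => f z - c) z • heatKernelGrad t (y - z)‖ₑ ≤
      (ball x (2 * R))ᶜ.indicator
        (fun z => ‖f z - c‖ₑ * ENNReal.ofReal ((‖z - x‖ ^ (d + 1))⁻¹)) z * ENNReal.ofReal A := by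
    intro z
    by_cases hz : z ∈ ball x (2 * R)
    · have hz' : z ∉ (ball x (2 * R))ᶜ := fun h => h hz
      simp [Set.indicator_of_notMem hz']
    · have hz' : z ∈ (ball x (2 * R))ᶜ := hz
      rw [Set.indicator_of_mem hz', Set.indicator_of_mem hz', enorm_smul, mul_assoc]
      gcongr
      rw [← ENNReal.ofReal_mul (by positivity), ← ofReal_norm]
      refine ENNReal.ofReal_le_ofReal ?_
      have := norm_heatKernelGrad_sub_le_far ht hR hy hz
      rw [← hd, ← hA] at this
      linarith [this, mul_comm A ((‖z - x‖ ^ (d + 1))⁻¹)]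
  have step1 : ‖heatExtensionGrad ((ball x (2 * R))ᶜ.indicator fun z => f z - c) t y‖ₑ ≤
      ∫⁻ z, ‖(ball x (2 * R))ᶜ.indicator (fun z => f z - c) z • heatKernelGrad t (y - z)‖ₑ :=
    enorm_integral_le_lintegral_enorm _
  have step2 : ∫⁻ z, ‖(ball x (2 * R))ᶜ.indicator (fun z => f z - c) z • heatKernelGrad t (y - z)‖ₑ ≤
      ∫⁻ z, (ball x (2 * R))ᶜ.indicator
        (fun z => ‖f z - c‖ₑ * ENNReal.ofReal ((‖z - x‖ ^ (d + 1))⁻¹)) z * ENNReal.ofReal A :=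
    lintegral_mono hpt
  have step3 : ∫⁻ z, (ball x (2 * R))ᶜ.indicator
        (fun z => ‖f z - c‖ₑ * ENNReal.ofReal ((‖z - x‖ ^ (d + 1))⁻¹)) z * ENNReal.ofReal A =
      (∫⁻ z in (ball x (2 * R))ᶜ, ‖f z - c‖ₑ * ENNReal.ofReal ((‖z - x‖ ^ (d + 1))⁻¹)) *
        ENNReal.ofReal A := by
    rw [lintegral_mul_const' _ _ ENNReal.ofReal_ne_top, lintegral_indicator measurableSet_ball.compl]
  have step4 : (∫⁻ z in (ball x (2 * R))ᶜ, ‖f z - c‖ₑ * ENNReal.ofReal ((‖z - x‖ ^ (d + 1))⁻¹)) *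
        ENNReal.ofReal A ≤
      ENNReal.ofReal (2 ^ (d + 1) * (1 + 2 ^ (d + 1)) * V * S / (2 * R)) * ENNReal.ofReal A := by
    gcongr
    have := hf.lintegral_compl_ball_enorm_sub_average_mul_le x h2R
    rw [← hd, ← hc, ← hS, ← hV] at this
    exact this
  have step5 : ENNReal.ofReal (2 ^ (d + 1) * (1 + 2 ^ (d + 1)) * V * S / (2 * R)) * ENNReal.ofReal A =
      ENNReal.ofReal ((d + 2).factorial * 2 ^ (d + 1) * (2 ^ (d + 1) * (1 + 2 ^ (d + 1))) * V * S / R) := by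
    rw [← ENNReal.ofReal_mul' hA0, hA]
    congr 1
    field_simp
  calc _ ≤ _ := step1
    _ ≤ _ := step2
    _ = _ := step3
    _ ≤ _ := step4
    _ = _ := step5

end Far

/-! ## The near part: `L²` facts -/

section Near

variable {E : Type*} [NormedAddCommGroup E] [InnerProductSpace ℝ E] [FiniteDimensional ℝ E]
  [MeasurableSpace E] [BorelSpace E]

/-- The near part `f₁ = (f - c) 1_{B}` is integrable for `f ∈ BMO`. [folklore] -/
theorem _root_.Literature.Analysis.FunctionSpaces.MemBMO.integrable_indicator_ball_sub {f : E → ℝ} (hf : MemBMO f) (x : E) (ρ : ℝ)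
    (c : ℝ) : Integrable ((ball x ρ).indicator fun z => f z - c) :=
  ((hf.integrableOn_ball x ρ).sub (integrableOn_const measure_ball_lt_top.ne enorm_ne_top :
    IntegrableOn (fun _ : E => c) (ball x ρ))).integrable_indicator measurableSet_ball

/-- `∫ ‖(h 1_B)‖² = ∫_B ‖h‖²`. [folklore] -/
theorem lintegral_enorm_indicator_sq (x : E) (ρ : ℝ) (h : E → ℝ) :
    ∫⁻ z, ‖(ball x ρ).indicator h z‖ₑ ^ 2 = ∫⁻ z in ball x ρ, ‖h z‖ₑ ^ 2 := by
  rw [← lintegral_indicator measurableSet_ball]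
  refine lintegral_congr fun z => ?_
  by_cases hz : z ∈ ball x ρ <;> simp [hz]

/-- The near part is in `L²` as soon as `∫_B |f - c|² < ∞`. [folklore] -/
theorem _root_.Literature.Analysis.FunctionSpaces.MemBMO.memLp_two_indicator_ball_sub {f : E → ℝ} (hf : MemBMO f) (x : E) (ρ : ℝ)
    (c : ℝ) (hfin : ∫⁻ z in ball x ρ, ‖f z - c‖ₑ ^ 2 < ∞) :
    MemLp ((ball x ρ).indicator fun z => f z - c) 2 volume := by
  have haesm : AEStronglyMeasurable ((ball x ρ).indicator fun z => f z - c) volume :=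
    (hf.integrable_indicator_ball_sub x ρ c).aestronglyMeasurable
  rw [memLp_two_iff_integrable_sq_norm haesm]
  refine ⟨haesm.norm.pow 2, ?_⟩
  rw [hasFiniteIntegral_iff_enorm]
  have h1 : ∀ z, ‖‖(ball x ρ).indicator (fun z => f z - c) z‖ ^ 2‖ₑ =
      ‖(ball x ρ).indicator (fun z => f z - c) z‖ₑ ^ 2 := fun z => by
    rw [Real.enorm_eq_ofReal (sq_nonneg _), ENNReal.ofReal_pow (norm_nonneg _), ofReal_norm]
  simp_rw [h1]
  rw [lintegral_enorm_indicator_sq]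
  exact hfin

omit [InnerProductSpace ℝ E] [FiniteDimensional ℝ E] [MeasurableSpace E] [BorelSpace E] in
/-- `‖a + b‖² ≤ 2‖a‖² + 2‖b‖²` in `ℝ≥0∞`. [folklore] -/
theorem enorm_add_sq_le (a b : E) : ‖a + b‖ₑ ^ 2 ≤ 2 * ‖a‖ₑ ^ 2 + 2 * ‖b‖ₑ ^ 2 := by
  have h : ‖a + b‖ ^ 2 ≤ 2 * ‖a‖ ^ 2 + 2 * ‖b‖ ^ 2 := by
    have h1 : ‖a + b‖ ^ 2 ≤ (‖a‖ + ‖b‖) ^ 2 :=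
      pow_le_pow_left₀ (norm_nonneg _) (norm_add_le a b) 2
    nlinarith [h1, sq_nonneg (‖a‖ - ‖b‖)]
  calc ‖a + b‖ₑ ^ 2 = ENNReal.ofReal (‖a + b‖ ^ 2) := by
        rw [← ofReal_norm, ENNReal.ofReal_pow (norm_nonneg _)]
    _ ≤ ENNReal.ofReal (2 * ‖a‖ ^ 2 + 2 * ‖b‖ ^ 2) := ENNReal.ofReal_le_ofReal h
    _ = 2 * ‖a‖ₑ ^ 2 + 2 * ‖b‖ₑ ^ 2 := by
        rw [ENNReal.ofReal_add (by positivity) (by positivity), ENNReal.ofReal_mul zero_le_two,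
          ENNReal.ofReal_mul zero_le_two, ENNReal.ofReal_pow (norm_nonneg _),
          ENNReal.ofReal_pow (norm_nonneg _), ofReal_norm, ofReal_norm, ENNReal.ofReal_ofNat]

end Near

/-! ## Assembly: the Carleson box estimate and fact (B) from John–Nirenberg -/

section Assembly

universe u

variable {E : Type u} [NormedAddCommGroup E] [InnerProductSpace ℝ E] [FiniteDimensional ℝ E]
  [MeasurableSpace E] [BorelSpace E]

/-- **The Carleson box estimate** (Grafakos, *Modern Fourier Analysis*, 3rd ed., proof of
Theorem 3.3.8 (b), in the heat-kernel form of Koch–Tataru's Definition 1.1): if `f ∈ BMO`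
satisfies the `L²` oscillation bound `∫_B |f - f_B|² ≤ C_J ‖f‖²_* |B|` on all balls (a consequence
of John–Nirenberg), then for every `x` and `R > 0`,
`∫₀^{R²} ∫_{B(x,R)} ‖∇e^{tΔ}f‖² dy dt ≤ (C_J 2^d + 2 K²) |B(0,1)| ‖f‖²_* R^d`, where
`K = (d+2)! 2^{d+1} 2^{d+1}(1+2^{d+1}) |B(0,1)|` is the constant of the far part: split
`f = f_{B*} + f₁ + f₂` (`B* = B(x,2R)`), use the energy inequality and the `L²` bound for `f₁`,
and the pointwise bound `enorm_heatExtensionGrad_far_le` for `f₂`. [cite: GrafakosMFA2014, Theorem 3.3.8 (b)] -/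
theorem lintegral_carlesonBox_le {f : E → ℝ} (hf : MemBMO f) {CJ : ℝ≥0}
    (hCJ : ∀ (x : E) (r : ℝ), 0 < r →
      ∫⁻ y in ball x r, ‖f y - ⨍ z in ball x r, f z‖ₑ ^ 2 ≤ CJ * eBMOSeminorm f ^ 2 * volume (ball x r))
    (x : E) {R : ℝ} (hR : 0 < R) :
    ∫⁻ t in Set.Ioo 0 (R ^ 2), ∫⁻ y in ball x R, ‖heatExtensionGrad f t y‖ₑ ^ 2 ≤
      ENNReal.ofReal (((CJ : ℝ) * 2 ^ Module.finrank ℝ E + 2 *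
        ((Module.finrank ℝ E + 2).factorial * 2 ^ (Module.finrank ℝ E + 1) *
          (2 ^ (Module.finrank ℝ E + 1) * (1 + 2 ^ (Module.finrank ℝ E + 1))) *
          volume.real (ball (0 : E) 1)) ^ 2) * volume.real (ball (0 : E) 1) *
        (eBMOSeminorm f).toReal ^ 2 * R ^ Module.finrank ℝ E) := by
  obtain ⟨d, hd⟩ : ∃ d : ℕ, d = Module.finrank ℝ E := ⟨_, rfl⟩
  obtain ⟨c, hc⟩ : ∃ c : ℝ, c = ⨍ w in ball x (2 * R), f w := ⟨_, rfl⟩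
  obtain ⟨S, hS⟩ : ∃ S : ℝ, S = (eBMOSeminorm f).toReal := ⟨_, rfl⟩
  obtain ⟨V, hV⟩ : ∃ V : ℝ, V = volume.real (ball (0 : E) 1) := ⟨_, rfl⟩
  obtain ⟨K, hK⟩ : ∃ K : ℝ, K = (d + 2).factorial * 2 ^ (d + 1) * (2 ^ (d + 1) * (1 + 2 ^ (d + 1))) * V :=
    ⟨_, rfl⟩
  rw [← hd, ← hS, ← hV, ← hK]
  have hS0 : 0 ≤ S := hS ▸ ENNReal.toReal_nonneg
  have hV0 : 0 ≤ V := hV ▸ measureReal_nonneg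
  have hK0 : 0 ≤ K := hK ▸ by positivity
  have hStop : eBMOSeminorm f ≠ ∞ := hf.2.ne
  have hSe : eBMOSeminorm f = ENNReal.ofReal S := by rw [hS, ENNReal.ofReal_toReal hStop]
  have hVe : volume (ball (0 : E) 1) = ENNReal.ofReal V := by
    rw [hV, measureReal_def, ENNReal.ofReal_toReal measure_ball_lt_top.ne]
  -- the two pieces
  obtain ⟨f₁, hf₁⟩ : ∃ f₁ : E → ℝ, f₁ = (ball x (2 * R)).indicator fun z => f z - c := ⟨_, rfl⟩
  obtain ⟨f₂, hf₂⟩ : ∃ f₂ : E → ℝ, f₂ = (ball x (2 * R))ᶜ.indicator fun z => f z - c := ⟨_, rfl⟩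
  have hCJ2 : ∫⁻ y in ball x (2 * R), ‖f y - c‖ₑ ^ 2 ≤
      CJ * eBMOSeminorm f ^ 2 * volume (ball x (2 * R)) := by
    have := hCJ x (2 * R) (by positivity)
    rw [← hc] at this
    exact this
  have hf₁i : Integrable f₁ := by
    rw [hf₁]
    exact hf.integrable_indicator_ball_sub x (2 * R) c
  have hfin : ∫⁻ z in ball x (2 * R), ‖f z - c‖ₑ ^ 2 < ∞ := by
    refine hCJ2.trans_lt ?_
    exact ENNReal.mul_lt_top (ENNReal.mul_lt_top ENNReal.coe_lt_top
      (ENNReal.pow_lt_top hf.2)) measure_ball_lt_top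
  have hf₁2 : MemLp f₁ 2 volume := by
    rw [hf₁]
    exact hf.memLp_two_indicator_ball_sub x (2 * R) c hfin
  -- pointwise splitting on the box
  have hsplit : ∀ t ∈ Set.Ioo (0 : ℝ) (R ^ 2), ∀ y ∈ ball x R,
      ‖heatExtensionGrad f t y‖ₑ ^ 2 ≤
        2 * ‖heatExtensionGrad f₁ t y‖ₑ ^ 2 + ENNReal.ofReal (2 * (K * S / R) ^ 2) := by
    intro t ht y hy
    have hfar := enorm_heatExtensionGrad_far_le hf x hR ht.1 hy
    rw [← hd, ← hc, ← hS, ← hV, ← hK, ← hf₂] at hfar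
    rw [heatExtensionGrad_eq_near_add_far hf x (2 * R) ht.1 y, ← hc, ← hf₁, ← hf₂]
    calc ‖heatExtensionGrad f₁ t y + heatExtensionGrad f₂ t y‖ₑ ^ 2
        ≤ 2 * ‖heatExtensionGrad f₁ t y‖ₑ ^ 2 + 2 * ‖heatExtensionGrad f₂ t y‖ₑ ^ 2 :=
          enorm_add_sq_le _ _
      _ ≤ 2 * ‖heatExtensionGrad f₁ t y‖ₑ ^ 2 + 2 * ENNReal.ofReal (K * S / R) ^ 2 := by
          gcongr
      _ = 2 * ‖heatExtensionGrad f₁ t y‖ₑ ^ 2 + ENNReal.ofReal (2 * (K * S / R) ^ 2) := by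
          rw [← ENNReal.ofReal_pow (by positivity), ENNReal.ofReal_mul zero_le_two,
            ENNReal.ofReal_ofNat]
  -- measurability of the near integrand
  have hG1m : Measurable fun p : ℝ × E => ‖heatExtensionGrad f₁ p.1 p.2‖ₑ ^ 2 :=
    (measurable_heatExtensionGrad hf₁i.aestronglyMeasurable).enorm.pow_const _
  have hG1s : ∀ t : ℝ, Measurable fun y : E => ‖heatExtensionGrad f₁ t y‖ₑ ^ 2 := fun t =>
    Measurable.of_uncurry_left (f := fun (t : ℝ) (y : E) => ‖heatExtensionGrad f₁ t y‖ₑ ^ 2) hG1m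
  have hG1m' : ∀ t : ℝ, Measurable fun y : E => 2 * ‖heatExtensionGrad f₁ t y‖ₑ ^ 2 := fun t =>
    (hG1s t).const_mul 2
  have hG1m'' : Measurable fun t : ℝ => 2 * ∫⁻ y in ball x R, ‖heatExtensionGrad f₁ t y‖ₑ ^ 2 :=
    (hG1m.lintegral_prod_right' (ν := volume.restrict (ball x R))).const_mul 2
  -- integrate the pointwise bound
  have step1 : ∫⁻ t in Set.Ioo 0 (R ^ 2), ∫⁻ y in ball x R, ‖heatExtensionGrad f t y‖ₑ ^ 2 ≤
      ∫⁻ t in Set.Ioo 0 (R ^ 2), ∫⁻ y in ball x R,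
        (2 * ‖heatExtensionGrad f₁ t y‖ₑ ^ 2 + ENNReal.ofReal (2 * (K * S / R) ^ 2)) :=
    setLIntegral_mono' measurableSet_Ioo fun t ht =>
      setLIntegral_mono' measurableSet_ball fun y hy => hsplit t ht y hy
  have step2 : ∫⁻ t in Set.Ioo 0 (R ^ 2), ∫⁻ y in ball x R,
        (2 * ‖heatExtensionGrad f₁ t y‖ₑ ^ 2 + ENNReal.ofReal (2 * (K * S / R) ^ 2)) =
      2 * (∫⁻ t in Set.Ioo 0 (R ^ 2), ∫⁻ y in ball x R, ‖heatExtensionGrad f₁ t y‖ₑ ^ 2) +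
        ENNReal.ofReal (2 * (K * S / R) ^ 2) * volume (ball x R) * volume (Set.Ioo (0 : ℝ) (R ^ 2)) := by
    have e1 : ∀ t : ℝ, ∫⁻ y in ball x R,
        (2 * ‖heatExtensionGrad f₁ t y‖ₑ ^ 2 + ENNReal.ofReal (2 * (K * S / R) ^ 2)) =
        2 * (∫⁻ y in ball x R, ‖heatExtensionGrad f₁ t y‖ₑ ^ 2) +
          ENNReal.ofReal (2 * (K * S / R) ^ 2) * volume (ball x R) := by
      intro t
      rw [lintegral_add_left (hG1m' t), lintegral_const_mul _ (hG1s t), setLIntegral_const]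
    rw [lintegral_congr e1]
    have hmo : Measurable fun t : ℝ => ∫⁻ y in ball x R, ‖heatExtensionGrad f₁ t y‖ₑ ^ 2 :=
      hG1m.lintegral_prod_right'
    rw [lintegral_add_left hG1m'', lintegral_const_mul _ hmo, setLIntegral_const, mul_assoc]
  -- the near part: energy inequality and the `L²` oscillation bound
  have step3 : ∫⁻ t in Set.Ioo 0 (R ^ 2), ∫⁻ y in ball x R, ‖heatExtensionGrad f₁ t y‖ₑ ^ 2 ≤
      ENNReal.ofReal (1 / 2) * ∫⁻ z, ‖f₁ z‖ₑ ^ 2 := by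
    calc ∫⁻ t in Set.Ioo 0 (R ^ 2), ∫⁻ y in ball x R, ‖heatExtensionGrad f₁ t y‖ₑ ^ 2
        ≤ ∫⁻ t in Set.Ioo 0 (R ^ 2), ∫⁻ y, ‖heatExtensionGrad f₁ t y‖ₑ ^ 2 :=
          lintegral_mono fun t => setLIntegral_le_lintegral _ _
      _ ≤ ∫⁻ t in Set.Ioi 0, ∫⁻ y, ‖heatExtensionGrad f₁ t y‖ₑ ^ 2 :=
          lintegral_mono_set Set.Ioo_subset_Ioi_self
      _ ≤ ENNReal.ofReal (1 / 2) * ∫⁻ z, ‖f₁ z‖ₑ ^ 2 :=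
          lintegral_Ioi_lintegral_enorm_heatExtensionGrad_sq_le hf₁i hf₁2
  have step4 : 2 * (ENNReal.ofReal (1 / 2) * ∫⁻ z, ‖f₁ z‖ₑ ^ 2) ≤
      ENNReal.ofReal (CJ * S ^ 2 * ((2 * R) ^ d * V)) := by
    rw [← mul_assoc, ← ENNReal.ofReal_ofNat 2, ← ENNReal.ofReal_mul zero_le_two,
      show (2 : ℝ) * (1 / 2) = 1 by norm_num, ENNReal.ofReal_one, one_mul, hf₁,
      lintegral_enorm_indicator_sq]
    refine hCJ2.trans (le_of_eq ?_)
    rw [Measure.addHaar_ball_of_pos _ x (by positivity : (0 : ℝ) < 2 * R), hVe, hSe, ← hd,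
      ← ENNReal.ofReal_pow hS0, ← ENNReal.ofReal_coe_nnreal,
      ← ENNReal.ofReal_mul (by positivity), ← ENNReal.ofReal_mul (by positivity),
      ← ENNReal.ofReal_mul (by positivity)]
  have step5 : ENNReal.ofReal (2 * (K * S / R) ^ 2) * volume (ball x R) *
        volume (Set.Ioo (0 : ℝ) (R ^ 2)) =
      ENNReal.ofReal (2 * (K * S / R) ^ 2 * (R ^ d * V) * R ^ 2) := by
    rw [Measure.addHaar_ball_of_pos _ x hR, hVe, Real.volume_Ioo, sub_zero, ← hd,
      ← ENNReal.ofReal_mul (by positivity), ← ENNReal.ofReal_mul (by positivity),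
      ← ENNReal.ofReal_mul (by positivity)]
  -- combine
  have hR0 : R ≠ 0 := hR.ne'
  calc ∫⁻ t in Set.Ioo 0 (R ^ 2), ∫⁻ y in ball x R, ‖heatExtensionGrad f t y‖ₑ ^ 2
      ≤ 2 * (∫⁻ t in Set.Ioo 0 (R ^ 2), ∫⁻ y in ball x R, ‖heatExtensionGrad f₁ t y‖ₑ ^ 2) +
          ENNReal.ofReal (2 * (K * S / R) ^ 2) * volume (ball x R) *
            volume (Set.Ioo (0 : ℝ) (R ^ 2)) := step1.trans_eq step2
    _ ≤ 2 * (ENNReal.ofReal (1 / 2) * ∫⁻ z, ‖f₁ z‖ₑ ^ 2) +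
          ENNReal.ofReal (2 * (K * S / R) ^ 2 * (R ^ d * V) * R ^ 2) := by
        rw [← step5]
        gcongr
    _ ≤ ENNReal.ofReal (CJ * S ^ 2 * ((2 * R) ^ d * V)) +
          ENNReal.ofReal (2 * (K * S / R) ^ 2 * (R ^ d * V) * R ^ 2) := by
        gcongr
    _ = ENNReal.ofReal ((CJ * 2 ^ d + 2 * K ^ 2) * V * S ^ 2 * R ^ d) := by
        rw [← ENNReal.ofReal_add (by positivity) (by positivity)]
        congr 1
        field_simp
        ring

/-- **Fact (B) from the John–Nirenberg inequality**: Fefferman–Stein's `BMO ⇒ Carleson` in the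
heat-kernel form of Koch–Tataru's Definition 1.1 (Grafakos, *Modern Fourier Analysis*, 3rd ed.,
Theorem 3.3.8 (b); Koch–Tataru 2001, remark after Definition 1.1), assuming the John–Nirenberg
inequality `Literature.Analysis.FunctionSpaces.john_nirenberg` (a named fact of `BMO.lean`, John–Nirenberg 1961, Lemma 1'):
there is `C = C(E)` with `sup_{x,R} R^{-d} ∫₀^{R²}∫_{B(x,R)} |∇e^{tΔ}f|² ≤ C ‖f‖²_*` for all
`f ∈ BMO(E)`. [cite: GrafakosMFA2014, Theorem 3.3.8 (b)] -/
theorem eCarlesonGradNorm_le_of_memBMO_of_john_nirenberg (hJN : john_nirenberg.{u, 0}) :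
    eCarlesonGradNorm_le_of_memBMO (E := E) := by
  obtain ⟨CJ, hCJ⟩ := exists_lintegral_ball_enorm_sub_average_sq_le (E := E) hJN
  obtain ⟨d, hd⟩ : ∃ d : ℕ, d = Module.finrank ℝ E := ⟨_, rfl⟩
  obtain ⟨V, hV⟩ : ∃ V : ℝ, V = volume.real (ball (0 : E) 1) := ⟨_, rfl⟩
  obtain ⟨Kb, hKb⟩ : ∃ Kb : ℝ, Kb = ((CJ : ℝ) * 2 ^ d + 2 *
      ((d + 2).factorial * 2 ^ (d + 1) * (2 ^ (d + 1) * (1 + 2 ^ (d + 1))) * V) ^ 2) * V := ⟨_, rfl⟩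
  have hV0 : 0 ≤ V := hV ▸ measureReal_nonneg
  have hKb0 : 0 ≤ Kb := hKb ▸ by positivity
  refine ⟨Kb.toNNReal, fun {f} hf => ?_⟩
  have hcoe : ((Kb.toNNReal : ℝ≥0) : ℝ≥0∞) = ENNReal.ofReal Kb := rfl
  rw [hcoe]
  obtain ⟨S, hS⟩ : ∃ S : ℝ, S = (eBMOSeminorm f).toReal := ⟨_, rfl⟩
  have hS0 : 0 ≤ S := hS ▸ ENNReal.toReal_nonneg
  have hSe : eBMOSeminorm f = ENNReal.ofReal S := by rw [hS, ENNReal.ofReal_toReal hf.2.ne]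
  refine iSup_le fun x => iSup₂_le fun R hR => ?_
  have hbox := lintegral_carlesonBox_le hf (hCJ f hf) x hR
  rw [← hd, ← hV, ← hS] at hbox
  rw [← hd]
  have hRd : ENNReal.ofReal (R ^ d) ≠ 0 := by
    rw [ne_eq, ENNReal.ofReal_eq_zero, not_le]
    positivity
  have h1 : (ENNReal.ofReal (R ^ d))⁻¹ *
        ∫⁻ t in Set.Ioo 0 (R ^ 2), ∫⁻ y in ball x R, ‖heatExtensionGrad f t y‖ₑ ^ 2 ≤
      (ENNReal.ofReal (R ^ d))⁻¹ * ENNReal.ofReal (Kb * S ^ 2 * R ^ d) := by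
    rw [hKb]
    exact mul_le_mul_right hbox _
  have h2 : (ENNReal.ofReal (R ^ d))⁻¹ * ENNReal.ofReal (Kb * S ^ 2 * R ^ d) =
      ENNReal.ofReal (Kb * S ^ 2) := by
    rw [ENNReal.ofReal_mul' (by positivity : (0 : ℝ) ≤ R ^ d),
      mul_comm (ENNReal.ofReal (Kb * S ^ 2)) _, ← mul_assoc,
      ENNReal.inv_mul_cancel hRd ENNReal.ofReal_ne_top, one_mul]
  have h3 : ENNReal.ofReal (Kb * S ^ 2) = ENNReal.ofReal Kb * eBMOSeminorm f ^ 2 := by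
    rw [hSe, ← ENNReal.ofReal_pow hS0, ← ENNReal.ofReal_mul hKb0]
  calc _ ≤ _ := h1
    _ = _ := h2
    _ = _ := h3

end Assembly

end BMOInv


/-! ## Koch–Tataru's Theorem 1 from John–Nirenberg, (D) and (E) -/

section KochTataru

universe u

variable {E : Type u} [NormedAddCommGroup E] [InnerProductSpace ℝ E] [FiniteDimensional ℝ E]
  [MeasurableSpace E] [BorelSpace E]

open BMOInv in
/-- **Koch–Tataru's Theorem 1 with (A), (B), (C) discharged**: the named fact
`Literature.Analysis.FunctionSpaces.memBMOInv_iff_carleson_heat` (Koch–Tataru 2001, Theorem 1) follows from the John–Nirenberg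
inequality (`Literature.Analysis.FunctionSpaces.john_nirenberg`, John–Nirenberg 1961, Lemma 1'), Koch–Tataru's converse in
Carleson form (D) and the Fefferman–Stein direction `Carleson ⇒ BMO` (E). [cite: KochTataruAdvMath2001, Theorem 1] -/
theorem memBMOInv_iff_carleson_heat_of_JN_D_E (hJN : john_nirenberg.{u, 0})
    (hD : exists_hasWeakDivergenceRepresentation_of_eCarlesonNorm_lt_top (E := E))
    (hE : memBMO_of_eCarlesonGradNorm_lt_top (E := E)) :
    memBMOInv_iff_carleson_heat (E := E) :=
  memBMOInv_iff_carleson_heat_of_BDE (eCarlesonGradNorm_le_of_memBMO_of_john_nirenberg hJN) hD hE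

end KochTataru

end Literature.Analysis.FunctionSpaces
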